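import Literature.MathematicalPhysics.QuantumFieldTheory.Balaban1983to89.B5Local114GLatticeFirst

/-!
# `Balaban1983to89.B5Local114GLatticeSecond` — Bałaban CMP 95 (1984), Proposition 1.2, (1.114) FOR `G = Δ_a⁻¹` on the
# lattice torus of record: the two SECOND-ORDER entries `‖ζ∇∇GJ‖, ‖ζG∇*∇*J‖ ≤ O(1)e^{−δ₀|y−y′|}|ζ|‖J‖` (UNDER the printed
# kernel bound (1.126) on `∂P∂*`), by a `C^{1,1}` localisation, the torus identity `Σ_{νν′}‖∇_ν∇_{ν′}u‖² = ‖Δu‖²`, and duality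

statement-level skeleton of published theorems with citation tags; proofs where landed; nothing here is a claim
about the Yang–Mills mass gap

Source (lit-balaban cell, Phase-2 proof seat p37 gen 7): T. Bałaban, *Propagators and renormalization transformations
for lattice gauge theories. I*, Commun. Math. Phys. **95** (1984) 17–40 [`Balaban1984PropagatorsI`, "B5"], Prop. 1.1
(1.89) p. 33 [PDF 17], Prop. 1.2 (1.114) p. 36 [PDF 20], p. 39 [PDF 23]; held as `paper:balaban1984-cmp95-propagators-rt-i`.
Unit `lit-balaban-p37`, HOME `run/shared/lean/pub/lit-balaban/` (SKELETON row B5.Prop1.2, owner's census item (vi)-G).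

## WHAT IS PRINTED (verbatim)

p. 36 [PDF 20], (1.114): «Finally there exists a constant O(1) such that
  ‖ζGJ‖, ‖ζ∇GJ‖, ‖ζG∇*J‖, ‖ζ∇G∇*J‖, ‖ζ∇∇GJ‖, ‖ζG∇*∇*J‖ ≤ O(1)e^{−δ₀|y−y′|}|ζ| ‖J‖   (1.114)
for supp ζ ⊂ Δ̃(y), supp J ⊂ Δ̃(y′).»
p. 33 [PDF 17], Prop. 1.1: «The operator G is a symmetric operator on L²(T_η) and … ‖∇∇GJ‖ … ‖G∇*∇*J‖ ≤ O(1)‖J‖ (1.89)».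
p. 39 [PDF 23]: «Let us notice that the proof of inequalities (1.114), describing the decay in L²-norms, is completed because
we have proved inequalities (1.89).»

## WHAT THIS MODULE PROVES (kernel-checked, zero sorry)

In r02's presentation (`B5Prop12FieldsLattice`), UNDER the hypothesis `h126` of `B5CombesThomasLatticeSolve`, for
`0 ≤ δ ≤ δ₁ = delta1 d a δ′ C`:
* §1–§3 a `C^{1,1}` PRODUCT CUT-OFF `χ_y` at scale one around `n·y` on the fine torus (`chi`): a quadratic-spline profile in
  each long coordinate direction (`M_μ ≥ 16`; identically `1` in the short ones), `χ_y = 1` two fine steps around `Δ̃(y)`,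
  `χ_y = 0` farther than `8` units from `n·y`, and the DISCRETE bounds `|χ_y(x+e_ν) − χ_y(x)| ≤ η`, `|χ_y(x+e_ν) + χ_y(x−e_ν)
  − 2χ_y(x)| ≤ η²` uniformly in `η = 1/n` and the torus (`chi_diff_le`, `chi_diff2_le`);
* §4 the lattice Leibniz rule for `Δ(χ_y v)` and its pointwise majorant `|Δ(χ_yv)| ≤ χ_y|Δv| + Σ_ν(|∇_νv(·−e_ν)| + |∇_νv| + |v|)`;
* §5–§6 the CORE: for `Δ_a v = f`, `supp f ⊂ Δ̃(y₁) × dirs`,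
  `Σ_{νν′} Σ_{x∈Δ̃(y)} |∇_ν∇_{ν′}v|² ≤ C₄² e^{−2δ|y−y₁|}‖f‖²` (`sum_cube_grad2_le`), from `∇∇v = ∇∇(χ_yv)` on `Δ̃(y)`,
  r02's `Σ‖∇_ν∇_{ν′}u‖² = ‖Δu‖²` (`B5Prop11G0Torus.sum_nsq_fdiff_fdiff`), `Δv = f + ∂P∂*v − aQ*Qv`, and the weighted solve and
  conjugated-operator norms of `B5CombesThomasLatticeSolve`;
* §7 the entries: `l2T_smulT_grad2G_le` (m = 4, `‖ζ∇∇GJ‖`) and, by duality through «G is a symmetric operator»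
  (`B5Prop11Lattice.DeltaA_inv_isHermitian`), `l2_smulV_GdivT2_le` (m = 5, `‖ζG∇*∇*J‖`).

## HONEST SCOPE / DIVERGENCE

Method = the p. 36 alternative (Combes–Thomas on the torus) plus an interior `H²` localisation, not the printed random walk —
see `B5CombesThomasLattice`; (1.126) enters as the explicit hypothesis `h126`; the cut-off `χ_y`, the threshold `16` and all
constants are ours (the paper prints none).  The family statement `B5.Local114Fam` is assembled in `B5Local114GLattice`.
CELL BOOK-KEEPING (lit-balaban): row B5.Prop1.2, census item (vi)-G (owner r02, referee ref-4); VALUE = the last two entries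
of (1.114) for G on the torus, kernel-checked modulo the printed leaf (1.126) — NOT summit progress.
-/

namespace Literature.MathematicalPhysics.QuantumFieldTheory.Balaban1983to89.B5Local114GLatticeSecond

open scoped BigOperators Matrix ComplexConjugate ComplexOrder Matrix.Norms.L2Operator
open Finset Complex Matrix
open Literature.MathematicalPhysics.QuantumFieldTheory.Balaban1983to89.B5Prop11Plancherel (Tor fine fdiff shiftM unitVec)
open Literature.MathematicalPhysics.QuantumFieldTheory.Balaban1983to89.B5Prop11Lower (Lap nsq nsq_nonneg
  star_dotProduct_self form_gram norm_star_dotProduct_le)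
open Literature.MathematicalPhysics.QuantumFieldTheory.Balaban1983to89.B5Prop11Lattice (gammaZero gammaZero_pos l2 l2T
  l2_nonneg l2T_nonneg l2_sq l2T_sq grad grad2 divT divT2 DeltaA_inv_isHermitian)
open Literature.MathematicalPhysics.QuantumFieldTheory.Balaban1983to89.B5Prop11G0Torus (sum_nsq_fdiff_fdiff)
open Literature.MathematicalPhysics.QuantumFieldTheory.Balaban1983to89.B5Prop12FieldsLattice (cdistF distU distSite
  toFine cubeT distU_nonneg distSite_nonneg toFine_mem_cubeT smulV smulT cutInL cutSupL cutSupL_nonneg)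
open Literature.MathematicalPhysics.QuantumFieldTheory.Balaban1983to89.B5DeltaA169 (DeltaA QvAdj)
open Literature.MathematicalPhysics.QuantumFieldTheory.Balaban1983to89.B5Block118 (QvOp)
open Literature.MathematicalPhysics.QuantumFieldTheory.Balaban1983to89.LatticeNorms (supNorm norm_le_supNorm supNorm_nonneg)
open Literature.MathematicalPhysics.QuantumFieldTheory.Balaban1983to89.B5SiteBridgeP12 (mem_cubeT_iff)
open Literature.MathematicalPhysics.QuantumFieldTheory.Balaban1983to89.B5RowSumsP12Lattice (distSite_comm)
open Literature.MathematicalPhysics.QuantumFieldTheory.Balaban1983to89.B5CoverP12Lattice (distU_comm)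
open Literature.MathematicalPhysics.QuantumFieldTheory.Balaban1983to89.B5CombesThomasLattice
open Literature.MathematicalPhysics.QuantumFieldTheory.Balaban1983to89.B5CombesThomasLatticeSolve
open Literature.MathematicalPhysics.QuantumFieldTheory.Balaban1983to89.B5Local114GLatticeFirst

noncomputable section

variable {d : ℕ}

/-! ## §1 The 1-D `C^{1,1}` profile in fine units -/

/-- the 1-D profile in fine steps `k = |x_μ − n y_μ|`: `1` for `k ≤ 3n`, the quadratic spline `1 − (k−3n)²/(2n²)` on
`[3n,4n]`, `(5n−k)²/(2n²)` on `[4n,5n]`, `0` beyond — a `C^{1,1}` cut-off at scale `n = η⁻¹` (first differences `≤ η`,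
second differences `≤ η²`). [cite: Balaban1984PropagatorsI, Prop. 1.2 (1.114) p.36 (ζ∇∇GJ: a smooth localisation to Δ̃(y)); construction ours] -/
def prof (n k : ℕ) : ℝ :=
  if k ≤ 3 * n then 1
  else if k ≤ 4 * n then 1 - ((k : ℝ) - 3 * n) ^ 2 / (2 * (n : ℝ) ^ 2)
  else if k ≤ 5 * n then (5 * (n : ℝ) - k) ^ 2 / (2 * (n : ℝ) ^ 2)
  else 0

/-- the profile is `1` up to `3n` fine steps. [cite: Balaban1984PropagatorsI, Prop. 1.2 (1.114) p.36 (localisation to Δ̃(y)); construction ours] -/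
theorem prof_of_le {n k : ℕ} (h : k ≤ 3 * n) : prof n k = 1 := by simp [prof, h]

/-- the profile vanishes beyond `5n` fine steps. [cite: Balaban1984PropagatorsI, Prop. 1.2 (1.114) p.36 (localisation to Δ̃(y)); construction ours] -/
theorem prof_of_gt {n k : ℕ} (h : 5 * n < k) : prof n k = 0 := by
  unfold prof
  rw [if_neg (by omega), if_neg (by omega), if_neg (by omega)]

/-- the first quadratic piece. [cite: Balaban1984PropagatorsI, Prop. 1.2 (1.114) p.36 (localisation to Δ̃(y)); construction ours] -/
theorem prof_eqB {n k : ℕ} (h1 : 3 * n < k) (h2 : k ≤ 4 * n) :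
    prof n k = 1 - ((k : ℝ) - 3 * n) ^ 2 / (2 * (n : ℝ) ^ 2) := by
  unfold prof; rw [if_neg (by omega), if_pos h2]

/-- the second quadratic piece. [cite: Balaban1984PropagatorsI, Prop. 1.2 (1.114) p.36 (localisation to Δ̃(y)); construction ours] -/
theorem prof_eqC {n k : ℕ} (h1 : 4 * n < k) (h2 : k ≤ 5 * n) :
    prof n k = (5 * (n : ℝ) - k) ^ 2 / (2 * (n : ℝ) ^ 2) := by
  unfold prof; rw [if_neg (by omega), if_neg (by omega), if_pos h2]

/-- `0 ≤ prof`. [cite: Balaban1984PropagatorsI, Prop. 1.2 (1.114) p.36 (localisation to Δ̃(y)); construction ours] -/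
theorem prof_nonneg (n k : ℕ) : 0 ≤ prof n k := by
  unfold prof
  split_ifs with h1 h2 h3
  · exact zero_le_one
  · have hk : ((k : ℝ) - 3 * n) ^ 2 ≤ (n : ℝ) ^ 2 := by
      have : (k : ℝ) ≤ 4 * n := by exact_mod_cast h2
      have : (3 * n : ℝ) < k := by exact_mod_cast (not_le.mp h1)
      nlinarith
    have hn : (0 : ℝ) < 2 * (n : ℝ) ^ 2 := by
      have : (0:ℝ) < n := by exact_mod_cast (show 0 < n by omega)
      positivity
    rw [sub_nonneg, div_le_one hn]; linarith
  · positivity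
  · exact le_rfl

/-- `prof ≤ 1`. [cite: Balaban1984PropagatorsI, Prop. 1.2 (1.114) p.36 (localisation to Δ̃(y)); construction ours] -/
theorem prof_le_one (n k : ℕ) : prof n k ≤ 1 := by
  unfold prof
  split_ifs with h1 h2 h3
  · exact le_rfl
  · have : 0 ≤ ((k : ℝ) - 3 * n) ^ 2 / (2 * (n : ℝ) ^ 2) := by positivity
    linarith
  · have hn : (0 : ℝ) < 2 * (n : ℝ) ^ 2 := by
      have : (0:ℝ) < n := by exact_mod_cast (show 0 < n by omega)
      positivity
    rw [div_le_one hn]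
    have : (4 * n : ℝ) < k := by exact_mod_cast (not_le.mp h2)
    have : (k : ℝ) ≤ 5 * n := by exact_mod_cast h3
    nlinarith
  · exact zero_le_one

/-- **first differences of the profile**: `|g(k+1) − g(k)| ≤ 1/n` (`= η`). [cite: Balaban1984PropagatorsI, Prop. 1.2 (1.114) p.36 (localisation to Δ̃(y)); construction ours] -/
theorem prof_diff_le {n : ℕ} (hn : 1 ≤ n) (k : ℕ) : |prof n (k + 1) - prof n k| ≤ 1 / n := by
  have hn0 : (0 : ℝ) < n := by exact_mod_cast hn
  have hn2 : (0 : ℝ) < 2 * (n : ℝ) ^ 2 := by positivity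
  have hn1 : (1 : ℝ) ≤ n := by exact_mod_cast hn
  unfold prof
  by_cases h1 : k + 1 ≤ 3 * n
  · rw [if_pos h1, if_pos (by omega)]; simp
  by_cases h2 : k ≤ 3 * n
  · -- k = 3n
    have hk : k = 3 * n := by omega
    rw [if_neg h1, if_pos (by omega), if_pos h2]
    subst hk
    push_cast
    rw [abs_le]; constructor
    · rw [le_sub_iff_add_le]
      have : ((3 * n : ℝ) + 1 - 3 * n) ^ 2 / (2 * (n:ℝ) ^ 2) ≤ 1 / n := by
        rw [div_le_div_iff₀ hn2 hn0]
        have e1 : ((3 * n : ℝ) + 1 - 3 * n) = 1 := by ring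
        rw [e1]; nlinarith
      linarith
    · have : 0 ≤ ((3 * n : ℝ) + 1 - 3 * n) ^ 2 / (2 * (n:ℝ) ^ 2) := by positivity
      have : (0:ℝ) ≤ 1 / n := by positivity
      linarith
  by_cases h3 : k + 1 ≤ 4 * n
  · rw [if_neg h1, if_pos h3, if_neg h2, if_pos (by omega)]
    push_cast
    have ha : (3 * n : ℝ) < k := by exact_mod_cast (show 3 * n < k by omega)
    have hb : (k : ℝ) + 1 ≤ 4 * n := by exact_mod_cast h3
    rw [abs_le]; constructor
    · have : (((k:ℝ) + 1 - 3 * n) ^ 2 - ((k:ℝ) - 3 * n) ^ 2) / (2 * (n:ℝ) ^ 2) ≤ 1 / n := by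
        rw [div_le_div_iff₀ hn2 hn0]; nlinarith
      have e : (1 - ((k:ℝ) + 1 - 3 * n) ^ 2 / (2 * (n:ℝ) ^ 2)) - (1 - ((k:ℝ) - 3 * n) ^ 2 / (2 * (n:ℝ) ^ 2))
          = -((((k:ℝ) + 1 - 3 * n) ^ 2 - ((k:ℝ) - 3 * n) ^ 2) / (2 * (n:ℝ) ^ 2)) := by ring
      rw [e]; linarith
    · have : 0 ≤ (((k:ℝ) + 1 - 3 * n) ^ 2 - ((k:ℝ) - 3 * n) ^ 2) / (2 * (n:ℝ) ^ 2) := by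
        apply div_nonneg _ hn2.le; nlinarith
      have e : (1 - ((k:ℝ) + 1 - 3 * n) ^ 2 / (2 * (n:ℝ) ^ 2)) - (1 - ((k:ℝ) - 3 * n) ^ 2 / (2 * (n:ℝ) ^ 2))
          = -((((k:ℝ) + 1 - 3 * n) ^ 2 - ((k:ℝ) - 3 * n) ^ 2) / (2 * (n:ℝ) ^ 2)) := by ring
      rw [e]; have : (0:ℝ) ≤ 1 / n := by positivity
      linarith
  by_cases h4 : k ≤ 4 * n
  · -- k = 4n
    have hk : k = 4 * n := by omega
    rw [if_neg h1, if_neg h3, if_pos (by omega), if_neg h2, if_pos h4]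
    subst hk
    push_cast
    have e : (5 * (n:ℝ) - (4 * n + 1)) ^ 2 / (2 * (n:ℝ) ^ 2) - (1 - ((4 * n : ℝ) - 3 * n) ^ 2 / (2 * (n:ℝ) ^ 2))
        = -((2 * (n:ℝ) - 1) / (2 * (n:ℝ) ^ 2)) := by field_simp; ring
    rw [e, abs_neg, abs_of_nonneg (by apply div_nonneg _ hn2.le; linarith), div_le_div_iff₀ hn2 hn0]
    nlinarith
  by_cases h5 : k + 1 ≤ 5 * n
  · rw [if_neg h1, if_neg h3, if_pos h5, if_neg h2, if_neg h4, if_pos (by omega)]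
    push_cast
    have ha : (4 * n : ℝ) < k := by exact_mod_cast (show 4 * n < k by omega)
    have hb : (k : ℝ) + 1 ≤ 5 * n := by exact_mod_cast h5
    have e : (5 * (n:ℝ) - (k + 1)) ^ 2 / (2 * (n:ℝ) ^ 2) - (5 * (n:ℝ) - k) ^ 2 / (2 * (n:ℝ) ^ 2)
        = -((2 * (5 * (n:ℝ) - k) - 1) / (2 * (n:ℝ) ^ 2)) := by field_simp; ring
    rw [e, abs_neg, abs_of_nonneg (by apply div_nonneg _ hn2.le; linarith), div_le_div_iff₀ hn2 hn0]
    nlinarith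
  by_cases h6 : k ≤ 5 * n
  · have hk : k = 5 * n := by omega
    rw [if_neg h1, if_neg h3, if_neg h5, if_neg h2, if_neg h4, if_pos h6]
    subst hk; push_cast; simp
  · rw [if_neg h1, if_neg h3, if_neg h5, if_neg h2, if_neg h4, if_neg h6]; simp


/-- **second differences of the profile**: `|g(k+2) + g(k) − 2g(k+1)| ≤ 1/n²` (`= η²`). [cite: Balaban1984PropagatorsI, Prop. 1.2 (1.114) p.36 (localisation to Δ̃(y)); construction ours] -/
theorem prof_diff2_le {n : ℕ} (hn : 1 ≤ n) (k : ℕ) :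
    |prof n (k + 2) + prof n k - 2 * prof n (k + 1)| ≤ 1 / (n : ℝ) ^ 2 := by
  have hn0 : (0 : ℝ) < n := by exact_mod_cast hn
  have hn1 : (1 : ℝ) ≤ n := by exact_mod_cast hn
  have hn2 : (0 : ℝ) < 2 * (n : ℝ) ^ 2 := by positivity
  have hnn : (0 : ℝ) < (n : ℝ) ^ 2 := by positivity
  have fin : ∀ e : ℝ, |e * (2 * (n : ℝ) ^ 2)| ≤ 2 →
      |e| ≤ 1 / (n : ℝ) ^ 2 := by
    intro e he
    rw [abs_mul, abs_of_pos hn2] at he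
    rw [le_div_iff₀ hnn]; linarith
  rcases (by omega : k + 2 ≤ 3 * n ∨ k + 1 = 3 * n ∨ k = 3 * n ∨ (3 * n < k ∧ k + 2 ≤ 4 * n) ∨
      (3 * n < k ∧ k + 1 = 4 * n) ∨ k = 4 * n ∨ (4 * n < k ∧ k + 2 ≤ 5 * n) ∨
      (4 * n < k ∧ k + 1 = 5 * n) ∨ k = 5 * n ∨ 5 * n < k) with
    h | h | h | ⟨h, h'⟩ | ⟨h, h'⟩ | h | ⟨h, h'⟩ | ⟨h, h'⟩ | h | h
  · rw [prof_of_le h, prof_of_le (by omega), prof_of_le (by omega)]; norm_num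
  · rw [prof_eqB (by omega) (by omega), prof_of_le (by omega), prof_of_le (by omega)]
    apply fin
    have e : (1 - (((k + 2 : ℕ) : ℝ) - 3 * n) ^ 2 / (2 * (n : ℝ) ^ 2) + 1 - 2 * 1)
        * (2 * (n : ℝ) ^ 2) = -((((k + 2 : ℕ) : ℝ) - 3 * n) ^ 2) := by
      field_simp; ring
    rw [e, abs_neg]
    have : (((k + 2 : ℕ) : ℝ) - 3 * n) = 1 := by
      push_cast; rw [show (k : ℝ) = 3 * n - 1 by
        have : ((k + 1 : ℕ) : ℝ) = 3 * n := by exact_mod_cast h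
        push_cast at this; linarith]; ring
    rw [this]; simp
  · subst h
    rcases (by omega : n = 1 ∨ 2 ≤ n) with h1 | h2
    · subst h1; rw [prof_eqC (by omega) (by omega), prof_of_le le_rfl, prof_eqB (by omega) (by omega)]
      push_cast; norm_num
    · rw [prof_eqB (by omega) (by omega), prof_of_le le_rfl, prof_eqB (by omega) (by omega)]
      apply fin
      have e : (1 - (((3 * n + 2 : ℕ) : ℝ) - 3 * n) ^ 2 / (2 * (n : ℝ) ^ 2) + 1 -
          2 * (1 - (((3 * n + 1 : ℕ) : ℝ) - 3 * n) ^ 2 / (2 * (n : ℝ) ^ 2))) * (2 * (n : ℝ) ^ 2)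
          = -2 := by
        field_simp; push_cast; ring
      rw [e]; norm_num
  · rw [prof_eqB (by omega) h', prof_eqB h (by omega), prof_eqB (by omega) (by omega)]
    apply fin
    have e : (1 - (((k + 2 : ℕ) : ℝ) - 3 * n) ^ 2 / (2 * (n : ℝ) ^ 2) +
        (1 - ((k : ℝ) - 3 * n) ^ 2 / (2 * (n : ℝ) ^ 2)) -
        2 * (1 - (((k + 1 : ℕ) : ℝ) - 3 * n) ^ 2 / (2 * (n : ℝ) ^ 2))) * (2 * (n : ℝ) ^ 2) = -2 := by
      field_simp; push_cast; ring
    rw [e]; norm_num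
  · rw [prof_eqC (by omega) (by omega), prof_eqB h (by omega), prof_eqB (by omega) (by omega)]
    apply fin
    have hk : (k : ℝ) = 4 * n - 1 := by
      have : ((k + 1 : ℕ) : ℝ) = 4 * n := by exact_mod_cast h'
      push_cast at this; linarith
    have e : ((5 * (n : ℝ) - ((k + 2 : ℕ) : ℝ)) ^ 2 / (2 * (n : ℝ) ^ 2) +
        (1 - ((k : ℝ) - 3 * n) ^ 2 / (2 * (n : ℝ) ^ 2)) -
        2 * (1 - (((k + 1 : ℕ) : ℝ) - 3 * n) ^ 2 / (2 * (n : ℝ) ^ 2))) * (2 * (n : ℝ) ^ 2) = 0 := by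
      field_simp; push_cast; rw [hk]; ring
    rw [e]; norm_num
  · subst h
    rcases (by omega : n = 1 ∨ 2 ≤ n) with h1 | h2
    · subst h1
      rw [prof_of_gt (by omega), prof_eqB (by omega) le_rfl, prof_eqC (by omega) (by omega)]
      push_cast; norm_num
    · rw [prof_eqC (by omega) (by omega), prof_eqB (by omega) le_rfl, prof_eqC (by omega) (by omega)]
      apply fin
      have e : ((5 * (n : ℝ) - ((4 * n + 2 : ℕ) : ℝ)) ^ 2 / (2 * (n : ℝ) ^ 2) +
          (1 - (((4 * n : ℕ) : ℝ) - 3 * n) ^ 2 / (2 * (n : ℝ) ^ 2)) -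
          2 * ((5 * (n : ℝ) - ((4 * n + 1 : ℕ) : ℝ)) ^ 2 / (2 * (n : ℝ) ^ 2))) * (2 * (n : ℝ) ^ 2)
          = 2 := by
        field_simp; push_cast; ring
      rw [e]; norm_num
  · rw [prof_eqC (by omega) h', prof_eqC h (by omega), prof_eqC (by omega) (by omega)]
    apply fin
    have e : ((5 * (n : ℝ) - ((k + 2 : ℕ) : ℝ)) ^ 2 / (2 * (n : ℝ) ^ 2) +
        (5 * (n : ℝ) - k) ^ 2 / (2 * (n : ℝ) ^ 2) -
        2 * ((5 * (n : ℝ) - ((k + 1 : ℕ) : ℝ)) ^ 2 / (2 * (n : ℝ) ^ 2))) * (2 * (n : ℝ) ^ 2) = 2 := by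
      field_simp; push_cast; ring
    rw [e]; norm_num
  · rw [prof_of_gt (by omega), prof_eqC h (by omega), prof_eqC (by omega) h'.le]
    apply fin
    have hk : (k : ℝ) = 5 * n - 1 := by
      have : ((k + 1 : ℕ) : ℝ) = 5 * n := by exact_mod_cast h'
      push_cast at this; linarith
    have e : (0 + (5 * (n : ℝ) - k) ^ 2 / (2 * (n : ℝ) ^ 2) -
        2 * ((5 * (n : ℝ) - ((k + 1 : ℕ) : ℝ)) ^ 2 / (2 * (n : ℝ) ^ 2))) * (2 * (n : ℝ) ^ 2) = 1 := by
      field_simp; push_cast; rw [hk]; ring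
    rw [e]; norm_num
  · subst h
    rw [prof_of_gt (by omega), prof_eqC (by omega) le_rfl, prof_of_gt (by omega)]
    push_cast; simp
  · rw [prof_of_gt (by omega), prof_of_gt h, prof_of_gt (by omega)]; norm_num


/-! ## §2 Circle arithmetic: one step on `ℤ/N` away from the antipode -/

/-- `|1| ≤ 1` on `ℤ/N` (centred representative). [folklore] -/
private theorem natAbs_valMinAbs_one_le (N : ℕ) [NeZero N] : ((1 : ZMod N).valMinAbs).natAbs ≤ 1 := by
  rw [ZMod.valMinAbs_natAbs_eq_min]
  rcases Nat.lt_or_ge 1 N with hN | hN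
  · rw [ZMod.val_one'' (by omega)]; exact min_le_left _ _
  · have : N = 1 := by have := NeZero.ne N; omega
    subst this
    simp

/-- away from the antipode, one step up on `ℤ/N` is one step up of the centred representative. [folklore] -/
private theorem valMinAbs_add_one {N : ℕ} [NeZero N] (z : ZMod N) (h : 2 * (z.valMinAbs.natAbs + 1) < N) :
    (z + 1).valMinAbs = z.valMinAbs + 1 := by
  rw [ZMod.valMinAbs_spec]
  have h1 : (2 * (z.valMinAbs.natAbs + 1 : ℕ) : ℤ) < N := by exact_mod_cast h
  push_cast at h1
  have h2 : -z.valMinAbs ≤ |z.valMinAbs| := neg_le_abs _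
  have h3 : z.valMinAbs ≤ |z.valMinAbs| := le_abs_self _
  refine ⟨by rw [Int.cast_add, Int.cast_one, ZMod.coe_valMinAbs], ?_, ?_⟩
  · linarith
  · linarith

/-- away from the antipode, one step down on `ℤ/N` is one step down of the centred representative. [folklore] -/
private theorem valMinAbs_sub_one {N : ℕ} [NeZero N] (z : ZMod N) (h : 2 * (z.valMinAbs.natAbs + 1) < N) :
    (z - 1).valMinAbs = z.valMinAbs - 1 := by
  rw [ZMod.valMinAbs_spec]
  have h1 : (2 * (z.valMinAbs.natAbs + 1 : ℕ) : ℤ) < N := by exact_mod_cast h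
  push_cast at h1
  have h2 : -z.valMinAbs ≤ |z.valMinAbs| := neg_le_abs _
  have h3 : z.valMinAbs ≤ |z.valMinAbs| := le_abs_self _
  refine ⟨by rw [Int.cast_sub, Int.cast_one, ZMod.coe_valMinAbs], ?_, ?_⟩
  · linarith
  · linarith

/-- `|z| ≤ |z + 1| + 1` for centred representatives. [folklore] -/
private theorem natAbs_valMinAbs_le_add_one {N : ℕ} [NeZero N] (z : ZMod N) :
    z.valMinAbs.natAbs ≤ (z + 1).valMinAbs.natAbs + 1 := by
  have h := ZMod.natAbs_valMinAbs_add_le (z + 1) (-1)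
  rw [show z + 1 + -1 = z by ring] at h
  refine h.trans ((Int.natAbs_add_le _ _).trans ?_)
  rw [ZMod.natAbs_valMinAbs_neg]
  exact Nat.add_le_add_left (natAbs_valMinAbs_one_le N) _

/-- `|z| ≤ |z − 1| + 1` for centred representatives. [folklore] -/
private theorem natAbs_valMinAbs_le_sub_one {N : ℕ} [NeZero N] (z : ZMod N) :
    z.valMinAbs.natAbs ≤ (z - 1).valMinAbs.natAbs + 1 := by
  have h := ZMod.natAbs_valMinAbs_add_le (z - 1) 1
  rw [show z - 1 + 1 = z by ring] at h
  refine h.trans ((Int.natAbs_add_le _ _).trans ?_)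
  exact Nat.add_le_add_left (natAbs_valMinAbs_one_le N) _

/-- `|z + 1| ≤ |z| + 1` for centred representatives. [folklore] -/
private theorem natAbs_valMinAbs_add_one_le {N : ℕ} [NeZero N] (z : ZMod N) :
    (z + 1).valMinAbs.natAbs ≤ z.valMinAbs.natAbs + 1 := by
  have h := ZMod.natAbs_valMinAbs_add_le z 1
  refine h.trans ((Int.natAbs_add_le _ _).trans ?_)
  exact Nat.add_le_add_left (natAbs_valMinAbs_one_le N) _

/-! ## §3 The 1-D factor and the product cut-off `χ_y` -/

section CutOff

variable (n : ℕ) [NeZero n] (M : Fin d → ℕ) [hM : ∀ μ, NeZero (M μ)]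

/-- the 1-D factor in direction `μ`: `prof n |z − c|` on `ℤ/(nM_μ)`. [cite: Balaban1984PropagatorsI, Prop. 1.2 (1.114) p.36 (localisation to Δ̃(y)); construction ours] -/
def fac (μ : Fin d) (c z : ZMod (fine n M μ)) : ℝ := prof n ((z - c).valMinAbs.natAbs)

/-- the 1-D factor of the cut-off at `y` in direction `μ` (identically `1` in the short directions `M_μ < 16`, where the
whole circle is within `8` units of `y_μ`). [cite: Balaban1984PropagatorsI, Prop. 1.2 (1.114) p.36; construction ours] -/
def facD (y : Tor M) (μ : Fin d) (z : ZMod (fine n M μ)) : ℝ :=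
  if 16 ≤ M μ then fac n M μ (toFine n M y μ) z else 1

/-- **the `C^{1,1}` product cut-off `χ_y`** at scale one around `n·y`: `= 1` within `3` units of `n·y` in every coordinate
(so on `Δ̃(y)` and two fine steps beyond), `= 0` farther than `8` units, `|∇χ| ≤ 1`, `|∇∇χ| ≤ 1` in units, uniformly in
`η = 1/n` and the torus. [cite: Balaban1984PropagatorsI, Prop. 1.2 (1.114) p.36 (ζ∇∇GJ); construction ours] -/
def chi (y : Tor M) (x : Tor (fine n M)) : ℝ := ∏ μ, facD n M y μ (x μ)

omit [NeZero n] hM in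
/-- `0 ≤ fac`. [cite: Balaban1984PropagatorsI, Prop. 1.2 (1.114) p.36 (localisation to Δ̃(y)); construction ours] -/
theorem fac_nonneg (μ : Fin d) (c z : ZMod (fine n M μ)) : 0 ≤ fac n M μ c z := prof_nonneg _ _

omit [NeZero n] hM in
/-- `fac ≤ 1`. [cite: Balaban1984PropagatorsI, Prop. 1.2 (1.114) p.36 (localisation to Δ̃(y)); construction ours] -/
theorem fac_le_one (μ : Fin d) (c z : ZMod (fine n M μ)) : fac n M μ c z ≤ 1 := prof_le_one _ _

omit [NeZero n] hM in
/-- `0 ≤ facD`. [cite: Balaban1984PropagatorsI, Prop. 1.2 (1.114) p.36 (localisation to Δ̃(y)); construction ours] -/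
theorem facD_nonneg (y : Tor M) (μ : Fin d) (z : ZMod (fine n M μ)) : 0 ≤ facD n M y μ z := by
  unfold facD; split_ifs; exacts [fac_nonneg n M μ _ _, zero_le_one]

omit [NeZero n] hM in
/-- `facD ≤ 1`. [cite: Balaban1984PropagatorsI, Prop. 1.2 (1.114) p.36 (localisation to Δ̃(y)); construction ours] -/
theorem facD_le_one (y : Tor M) (μ : Fin d) (z : ZMod (fine n M μ)) : facD n M y μ z ≤ 1 := by
  unfold facD; split_ifs; exacts [fac_le_one n M μ _ _, le_rfl]

omit [NeZero n] hM in
/-- `0 ≤ χ_y`. [cite: Balaban1984PropagatorsI, Prop. 1.2 (1.114) p.36 (localisation to Δ̃(y)); construction ours] -/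
theorem chi_nonneg (y : Tor M) (x : Tor (fine n M)) : 0 ≤ chi n M y x :=
  Finset.prod_nonneg fun μ _ => facD_nonneg n M y μ (x μ)

omit [NeZero n] hM in
/-- `χ_y ≤ 1`. [cite: Balaban1984PropagatorsI, Prop. 1.2 (1.114) p.36 (localisation to Δ̃(y)); construction ours] -/
theorem chi_le_one (y : Tor M) (x : Tor (fine n M)) : chi n M y x ≤ 1 :=
  Finset.prod_le_one (fun μ _ => facD_nonneg n M y μ (x μ)) fun μ _ => facD_le_one n M y μ (x μ)

omit [NeZero n] hM in
/-- `χ_y = 1` within `3` units of `n·y` coordinatewise. [cite: Balaban1984PropagatorsI, Prop. 1.2 (1.114) p.36 (supp ζ ⊂ Δ̃(y)); construction ours] -/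
theorem chi_eq_one_of {y : Tor M} {x : Tor (fine n M)} (h : ∀ μ, cdistF n M x (toFine n M y) μ ≤ 3 * n) :
    chi n M y x = 1 := by
  unfold chi
  refine Finset.prod_eq_one fun μ _ => ?_
  unfold facD fac
  split_ifs
  · exact prof_of_le (h μ)
  · rfl

/-- `χ_y(x) ≠ 0 ⇒` every coordinate of `x` is within `8` units of `n·y`. [cite: Balaban1984PropagatorsI, Prop. 1.2 (1.114) p.36; construction ours] -/
theorem cdistF_le_of_chi_ne_zero {y : Tor M} {x : Tor (fine n M)} (h : chi n M y x ≠ 0) (μ : Fin d) :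
    cdistF n M x (toFine n M y) μ ≤ 8 * n := by
  have hμ : facD n M y μ (x μ) ≠ 0 := fun h0 => h (Finset.prod_eq_zero (Finset.mem_univ μ) h0)
  unfold facD at hμ
  split_ifs at hμ with h16
  · unfold fac at hμ
    have : ¬ 5 * n < ((x μ - toFine n M y μ).valMinAbs).natAbs := fun hk => hμ (prof_of_gt hk)
    unfold cdistF; omega
  · unfold cdistF
    have h1 := ZMod.natAbs_valMinAbs_le (x μ - toFine n M y μ)
    have h2 : fine n M μ ≤ n * 15 := Nat.mul_le_mul_left _ (by omega)
    have h3 : fine n M μ / 2 ≤ 8 * n := by omega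
    exact h1.trans h3

omit [NeZero n] hM in
/-- coordinatewise bounds give a bound in units: `(∀ μ, cdistF ≤ k n) ⇒ distU ≤ k`. [cite: Balaban1984PropagatorsI, (1.109) p.35 (|x − x′|)] -/
theorem distU_le_of_forall (hn : 1 ≤ n) {x x' : Tor (fine n M)} {k : ℕ} (h : ∀ μ, cdistF n M x x' μ ≤ k * n) :
    distU n M x x' ≤ k := by
  unfold distU
  have hn0 : (0 : ℝ) < n := by exact_mod_cast hn
  rw [div_le_iff₀ hn0]
  have : Finset.univ.sup (cdistF n M x x') ≤ k * n := Finset.sup_le fun μ _ => h μ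
  exact_mod_cast this

/-- the support of `χ_y` is within `8` units of `n·y`: `χ_y(x) ≠ 0 ⇒ |x − n·y| ≤ 8`. [cite: Balaban1984PropagatorsI, Prop. 1.2 (1.114) p.36 (localisation to Δ̃(y)); construction ours] -/
theorem distU_le_of_chi_ne_zero (hn : 1 ≤ n) {y : Tor M} {x : Tor (fine n M)} (h : chi n M y x ≠ 0) :
    distU n M x (toFine n M y) ≤ 8 :=
  by exact_mod_cast distU_le_of_forall n M hn (k := 8) (cdistF_le_of_chi_ne_zero n M h)

/-- the 1-D difference bounds: `|f(z+1) − f(z)| ≤ 1/n`, `|f(z+1) + f(z−1) − 2f(z)| ≤ 1/n²` when `M_μ ≥ 16` (away from the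
antipode the circle is a line; near it all three values vanish). [cite: Balaban1984PropagatorsI, Prop. 1.2 (1.114) p.36; construction ours] -/
theorem fac_diff_le (hn : 1 ≤ n) {μ : Fin d} (h16 : 16 ≤ M μ) (c z : ZMod (fine n M μ)) :
    |fac n M μ c (z + 1) - fac n M μ c z| ≤ 1 / n ∧
      |fac n M μ c (z + 1) + fac n M μ c (z - 1) - 2 * fac n M μ c z| ≤ 1 / (n : ℝ) ^ 2 := by
  unfold fac
  rw [show z + 1 - c = (z - c) + 1 by ring, show z - 1 - c = (z - c) - 1 by ring]
  have hN : 16 * n ≤ fine n M μ := by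
    show 16 * n ≤ n * M μ
    rw [mul_comm]; exact Nat.mul_le_mul_left _ h16
  have hpos1 : (0 : ℝ) ≤ 1 / n := by positivity
  have hpos2 : (0 : ℝ) ≤ 1 / (n : ℝ) ^ 2 := by positivity
  by_cases hint : 2 * ((z - c).valMinAbs.natAbs + 1) < fine n M μ
  · rw [valMinAbs_add_one (z - c) hint, valMinAbs_sub_one (z - c) hint]
    obtain ⟨s, hs⟩ : ∃ s, (z - c).valMinAbs = s := ⟨_, rfl⟩
    rw [hs]
    rcases lt_trichotomy s 0 with hneg | h0 | hposs
    · -- s ≤ -1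
      obtain ⟨k, hk⟩ : ∃ k : ℕ, s.natAbs = k + 1 := ⟨s.natAbs - 1, by omega⟩
      have e1 : (s + 1).natAbs = k := by omega
      have e2 : (s - 1).natAbs = k + 2 := by omega
      rw [e1, e2, hk]
      refine ⟨?_, ?_⟩
      · rw [abs_sub_comm]; exact prof_diff_le hn k
      · have A := prof_diff2_le hn k
        rwa [add_comm (prof n (k + 2))] at A
    · subst h0
      simp only [zero_add, zero_sub, Int.natAbs_one, Int.natAbs_neg, Int.natAbs_zero]
      rw [prof_of_le (by omega : 1 ≤ 3 * n), prof_of_le (by omega : 0 ≤ 3 * n)]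
      norm_num
    · obtain ⟨k, hk⟩ : ∃ k : ℕ, s.natAbs = k + 1 := ⟨s.natAbs - 1, by omega⟩
      have e1 : (s + 1).natAbs = k + 2 := by omega
      have e2 : (s - 1).natAbs = k := by omega
      rw [e1, e2, hk]
      exact ⟨prof_diff_le hn (k + 1), prof_diff2_le hn k⟩
  · -- near the antipode everything vanishes
    have hk : 5 * n < (z - c).valMinAbs.natAbs := by omega
    have hk1 : 5 * n < (z - c + 1).valMinAbs.natAbs := by
      have := natAbs_valMinAbs_le_add_one (z - c); omega
    have hk2 : 5 * n < (z - c - 1).valMinAbs.natAbs := by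
      have := natAbs_valMinAbs_le_sub_one (z - c); omega
    rw [prof_of_gt hk1, prof_of_gt hk2, prof_of_gt hk]
    norm_num

/-- the 1-D difference bounds for `facD` (trivial in the short directions). [cite: Balaban1984PropagatorsI, Prop. 1.2 (1.114) p.36 (localisation to Δ̃(y)); construction ours] -/
theorem facD_diff_le (hn : 1 ≤ n) (y : Tor M) (μ : Fin d) (z : ZMod (fine n M μ)) :
    |facD n M y μ (z + 1) - facD n M y μ z| ≤ 1 / n ∧
      |facD n M y μ (z + 1) + facD n M y μ (z - 1) - 2 * facD n M y μ z| ≤ 1 / (n : ℝ) ^ 2 := by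
  unfold facD
  split_ifs with h16
  · exact fac_diff_le n M hn h16 _ z
  · norm_num

omit [NeZero n] hM in
/-- splitting off the factor in direction `ν`. [cite: Balaban1984PropagatorsI, Prop. 1.2 (1.114) p.36; construction ours] -/
theorem chi_eq_mul (y : Tor M) (x : Tor (fine n M)) (ν : Fin d) :
    chi n M y x = facD n M y ν (x ν) * ∏ μ ∈ Finset.univ.erase ν, facD n M y μ (x μ) := by
  unfold chi
  exact (Finset.mul_prod_erase Finset.univ (fun μ => facD n M y μ (x μ)) (Finset.mem_univ ν)).symm

omit [NeZero n] hM in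
/-- `χ_y(x + e_ν)`: only the factor in direction `ν` moves. [cite: Balaban1984PropagatorsI, Prop. 1.2 (1.114) p.36 (localisation to Δ̃(y)); construction ours] -/
theorem chi_add_unitVec_eq_mul (y : Tor M) (x : Tor (fine n M)) (ν : Fin d) :
    chi n M y (x + unitVec (fine n M) ν) = facD n M y ν (x ν + 1) * ∏ μ ∈ Finset.univ.erase ν, facD n M y μ (x μ) := by
  rw [chi_eq_mul n M y _ ν]
  congr 1
  · unfold unitVec; simp
  · refine Finset.prod_congr rfl fun μ hμ => ?_
    unfold unitVec; rw [Pi.add_apply, Pi.single_eq_of_ne (Finset.ne_of_mem_erase hμ), add_zero]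

omit [NeZero n] hM in
/-- `χ_y(x − e_ν)`: only the factor in direction `ν` moves. [cite: Balaban1984PropagatorsI, Prop. 1.2 (1.114) p.36 (localisation to Δ̃(y)); construction ours] -/
theorem chi_sub_unitVec_eq_mul (y : Tor M) (x : Tor (fine n M)) (ν : Fin d) :
    chi n M y (x - unitVec (fine n M) ν) = facD n M y ν (x ν - 1) * ∏ μ ∈ Finset.univ.erase ν, facD n M y μ (x μ) := by
  rw [chi_eq_mul n M y _ ν]
  congr 1
  · unfold unitVec; simp
  · refine Finset.prod_congr rfl fun μ hμ => ?_
    unfold unitVec; rw [Pi.sub_apply, Pi.single_eq_of_ne (Finset.ne_of_mem_erase hμ), sub_zero]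

/-- **`|∇χ_y| ≤ 1` in units**: `|χ_y(x + e_ν) − χ_y(x)| ≤ 1/n`. [cite: Balaban1984PropagatorsI, Prop. 1.2 (1.114) p.36; construction ours] -/
theorem chi_diff_le (hn : 1 ≤ n) (y : Tor M) (x : Tor (fine n M)) (ν : Fin d) :
    |chi n M y (x + unitVec (fine n M) ν) - chi n M y x| ≤ 1 / n := by
  rw [chi_add_unitVec_eq_mul, chi_eq_mul n M y x ν, ← sub_mul, abs_mul]
  have hP0 : 0 ≤ ∏ μ ∈ Finset.univ.erase ν, facD n M y μ (x μ) := Finset.prod_nonneg fun μ _ => facD_nonneg n M y μ _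
  have hP1 : ∏ μ ∈ Finset.univ.erase ν, facD n M y μ (x μ) ≤ 1 :=
    Finset.prod_le_one (fun μ _ => facD_nonneg n M y μ _) fun μ _ => facD_le_one n M y μ _
  rw [abs_of_nonneg hP0]
  calc |facD n M y ν (x ν + 1) - facD n M y ν (x ν)| * ∏ μ ∈ Finset.univ.erase ν, facD n M y μ (x μ)
      ≤ 1 / (n : ℝ) * 1 := mul_le_mul (facD_diff_le n M hn y ν (x ν)).1 hP1 hP0 (by positivity)
    _ = 1 / (n : ℝ) := mul_one _

/-- **`|∇∇χ_y| ≤ 1` in units**: `|χ_y(x + e_ν) + χ_y(x − e_ν) − 2χ_y(x)| ≤ 1/n²`. [cite: Balaban1984PropagatorsI, Prop. 1.2 (1.114) p.36; construction ours] -/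
theorem chi_diff2_le (hn : 1 ≤ n) (y : Tor M) (x : Tor (fine n M)) (ν : Fin d) :
    |chi n M y (x + unitVec (fine n M) ν) + chi n M y (x - unitVec (fine n M) ν) - 2 * chi n M y x|
      ≤ 1 / (n : ℝ) ^ 2 := by
  rw [chi_add_unitVec_eq_mul, chi_sub_unitVec_eq_mul, chi_eq_mul n M y x ν]
  have hP0 : 0 ≤ ∏ μ ∈ Finset.univ.erase ν, facD n M y μ (x μ) := Finset.prod_nonneg fun μ _ => facD_nonneg n M y μ _
  have hP1 : ∏ μ ∈ Finset.univ.erase ν, facD n M y μ (x μ) ≤ 1 :=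
    Finset.prod_le_one (fun μ _ => facD_nonneg n M y μ _) fun μ _ => facD_le_one n M y μ _
  rw [show facD n M y ν (x ν + 1) * ∏ μ ∈ Finset.univ.erase ν, facD n M y μ (x μ)
      + facD n M y ν (x ν - 1) * ∏ μ ∈ Finset.univ.erase ν, facD n M y μ (x μ)
      - 2 * (facD n M y ν (x ν) * ∏ μ ∈ Finset.univ.erase ν, facD n M y μ (x μ))
      = (facD n M y ν (x ν + 1) + facD n M y ν (x ν - 1) - 2 * facD n M y ν (x ν))
        * ∏ μ ∈ Finset.univ.erase ν, facD n M y μ (x μ) by ring, abs_mul, abs_of_nonneg hP0]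
  calc |facD n M y ν (x ν + 1) + facD n M y ν (x ν - 1) - 2 * facD n M y ν (x ν)|
        * ∏ μ ∈ Finset.univ.erase ν, facD n M y μ (x μ)
      ≤ 1 / (n : ℝ) ^ 2 * 1 := mul_le_mul (facD_diff_le n M hn y ν (x ν)).2 hP1 hP0 (by positivity)
    _ = _ := mul_one _

/-- one fine step moves a coordinate distance by at most one: `cdistF (x + e_ν) x′ μ ≤ cdistF x x′ μ + 1`. [cite: Balaban1984PropagatorsI, (1.109) p.35 (|x − x′|)] -/
theorem cdistF_add_unitVec_le (x x' : Tor (fine n M)) (ν μ : Fin d) :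
    cdistF n M (x + unitVec (fine n M) ν) x' μ ≤ cdistF n M x x' μ + 1 := by
  unfold cdistF unitVec
  rw [Pi.add_apply, show x μ + Pi.single (M := fun μ => ZMod (fine n M μ)) ν 1 μ - x' μ
    = (x μ - x' μ) + Pi.single (M := fun μ => ZMod (fine n M μ)) ν 1 μ by ring]
  by_cases hμ : μ = ν
  · subst hμ; rw [Pi.single_eq_same]; exact natAbs_valMinAbs_add_one_le _
  · rw [Pi.single_eq_of_ne hμ, add_zero]; omega

/-- `χ_y = 1` two fine steps around `Δ̃(y)`: if `x ∈ Δ̃(y)` then `χ_y = 1` at `x`, `x + e_ν`, `x + e_ν + e_ν′`. [cite: Balaban1984PropagatorsI, Prop. 1.2 (1.114) p.36 (supp ζ ⊂ Δ̃(y)); construction ours] -/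
theorem chi_eq_one_near_cube (hn : 1 ≤ n) {y : Tor M} {x : Tor (fine n M)} (hx : x ∈ cubeT n M y) (ν ν' : Fin d) :
    chi n M y x = 1 ∧ chi n M y (x + unitVec (fine n M) ν) = 1 ∧
      chi n M y (x + unitVec (fine n M) ν + unitVec (fine n M) ν') = 1 := by
  rw [mem_cubeT_iff] at hx
  refine ⟨chi_eq_one_of n M fun μ => (hx μ).trans (by omega), chi_eq_one_of n M fun μ => ?_,
    chi_eq_one_of n M fun μ => ?_⟩
  · have := cdistF_add_unitVec_le n M x (toFine n M y) ν μ; have := hx μ; omega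
  · have := cdistF_add_unitVec_le n M (x + unitVec (fine n M) ν) (toFine n M y) ν' μ
    have := cdistF_add_unitVec_le n M x (toFine n M y) ν μ; have := hx μ; omega

end CutOff

/-! ## §4 The lattice Leibniz rule for `Δ(χ_y v)` -/

section Leibniz

variable (n : ℕ) [NeZero n] (M : Fin d → ℕ) [hM : ∀ μ, NeZero (M μ)]

/-- the backward neighbour bond `(x − e_ν, μ)`. [cite: Balaban1984PropagatorsI, (1.31) p.23] -/
def pb (ν : Fin d) (i : Tor (fine n M) × Fin d) : Tor (fine n M) × Fin d := (i.1 - unitVec (fine n M) ν, i.2)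

omit [NeZero n] hM in
/-- `(x − e_ν) + e_ν = x`. [cite: Balaban1984PropagatorsI, (1.31) p.23] -/
@[simp] theorem nb_pb (ν : Fin d) (i : Tor (fine n M) × Fin d) : nb n M ν (pb n M ν i) = i := by
  obtain ⟨x, κ⟩ := i; simp [nb, pb]

omit [NeZero n] hM in
/-- `(x + e_ν) − e_ν = x`. [cite: Balaban1984PropagatorsI, (1.31) p.23] -/
@[simp] theorem pb_nb (ν : Fin d) (i : Tor (fine n M) × Fin d) : pb n M ν (nb n M ν i) = i := by
  obtain ⟨x, κ⟩ := i; simp [nb, pb]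

/-- `(∇_ν^* u)_μ(x) = c̄ (u_μ(x − e_ν) − u_μ(x))` (the adjoint difference, (1.21)).
[cite: Balaban1984PropagatorsI, (1.21) p.21, (1.31) p.23] -/
theorem fdiffH_apply (c : ℂ) (ν : Fin d) (u : Tor (fine n M) × Fin d → ℂ) (i : Tor (fine n M) × Fin d) :
    ((fdiff (fine n M) c ν)ᴴ *ᵥ u) i = conj c * (u (pb n M ν i) - u i) := by
  have hS : ((shiftM (fine n M) ν)ᴴ *ᵥ u) i = u (pb n M ν i) := by
    simp only [Matrix.mulVec, dotProduct, Matrix.conjTranspose_apply]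
    rw [Finset.sum_eq_single (pb n M ν i)]
    · simp [shiftM, pb]
    · intro j _ hj
      have hij : ¬ i = (j.1 + unitVec (fine n M) ν, j.2) := by
        rintro rfl
        exact hj (by simp [pb])
      simp [shiftM, hij]
    · intro h; exact absurd (Finset.mem_univ _) h
  rw [fdiff, Matrix.conjTranspose_smul, Matrix.conjTranspose_sub, Matrix.conjTranspose_one, Matrix.smul_mulVec,
    Pi.smul_apply, Matrix.sub_mulVec, Pi.sub_apply, hS, Matrix.one_mulVec, smul_eq_mul, Complex.star_def]

/-- `(∇_ν^*∇_ν u)(i) = n²(2u(i) − u(i − e_ν) − u(i + e_ν))`. [cite: Balaban1984PropagatorsI, (1.21) p.21, (1.31) p.23] -/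
theorem lapTerm_apply (ν : Fin d) (u : Tor (fine n M) × Fin d → ℂ) (i : Tor (fine n M) × Fin d) :
    (((fdiff (fine n M) (n : ℂ) ν)ᴴ * fdiff (fine n M) (n : ℂ) ν) *ᵥ u) i
      = ((n : ℂ) * n) * (2 * u i - u (pb n M ν i) - u (nb n M ν i)) := by
  rw [← Matrix.mulVec_mulVec, fdiffH_apply, fdiff_apply, fdiff_apply, nb_pb, map_natCast]
  ring

/-- `(Δu)(i) = Σ_ν n²(2u(i) − u(i − e_ν) − u(i + e_ν))`. [cite: Balaban1984PropagatorsI, (1.21) p.21, (1.31) p.23] -/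
theorem Lap_apply (u : Tor (fine n M) × Fin d → ℂ) (i : Tor (fine n M) × Fin d) :
    (Lap n M *ᵥ u) i = ∑ ν, ((n : ℂ) * n) * (2 * u i - u (pb n M ν i) - u (nb n M ν i)) := by
  rw [Lap, Matrix.sum_mulVec, Finset.sum_apply]
  exact Finset.sum_congr rfl fun ν _ => lapTerm_apply n M ν u i

/-- **the lattice Leibniz rule**, one direction: `∇_ν^*∇_ν(χv) = χ∇_ν^*∇_νv − b·(∇_νv)(·−e_ν) − a·∇_νv + c·v` with
`a = n(χ⁺ − χ)`, `b = n(χ − χ⁻)`, `c = n²(2χ − χ⁻ − χ⁺)`. [cite: Balaban1984PropagatorsI, (1.31) p.23, Prop. 1.2 (1.114) p.36 (ζ∇∇GJ); proof ours] -/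
theorem lapTerm_smulV (χ : Tor (fine n M) → ℝ) (v : Tor (fine n M) × Fin d → ℂ) (ν : Fin d) (i : Tor (fine n M) × Fin d) :
    (((fdiff (fine n M) (n : ℂ) ν)ᴴ * fdiff (fine n M) (n : ℂ) ν) *ᵥ smulV n M χ v) i
      = (χ i.1 : ℂ) * (((fdiff (fine n M) (n : ℂ) ν)ᴴ * fdiff (fine n M) (n : ℂ) ν) *ᵥ v) i
        - (((n : ℝ) * (χ i.1 - χ (pb n M ν i).1) : ℝ) : ℂ) * (fdiff (fine n M) (n : ℂ) ν *ᵥ v) (pb n M ν i)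
        - (((n : ℝ) * (χ (nb n M ν i).1 - χ i.1) : ℝ) : ℂ) * (fdiff (fine n M) (n : ℂ) ν *ᵥ v) i
        + (((n : ℝ) ^ 2 * (2 * χ i.1 - χ (pb n M ν i).1 - χ (nb n M ν i).1) : ℝ) : ℂ) * v i := by
  rw [lapTerm_apply, lapTerm_apply, fdiff_apply, fdiff_apply, nb_pb]
  simp only [smulV]
  push_cast
  ring

/-- summed over directions: `Δ(χv) = χΔv + Σ_ν(−b_ν(∇_νv)(·−e_ν) − a_ν∇_νv + c_νv)`.
[cite: Balaban1984PropagatorsI, (1.31) p.23, Prop. 1.2 (1.114) p.36 (ζ∇∇GJ); proof ours] -/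
theorem Lap_smulV_eq (χ : Tor (fine n M) → ℝ) (v : Tor (fine n M) × Fin d → ℂ) (i : Tor (fine n M) × Fin d) :
    (Lap n M *ᵥ smulV n M χ v) i = (χ i.1 : ℂ) * (Lap n M *ᵥ v) i
      + ∑ ν, (-((((n : ℝ) * (χ i.1 - χ (pb n M ν i).1) : ℝ) : ℂ) * (fdiff (fine n M) (n : ℂ) ν *ᵥ v) (pb n M ν i))
        - (((n : ℝ) * (χ (nb n M ν i).1 - χ i.1) : ℝ) : ℂ) * (fdiff (fine n M) (n : ℂ) ν *ᵥ v) i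
        + (((n : ℝ) ^ 2 * (2 * χ i.1 - χ (pb n M ν i).1 - χ (nb n M ν i).1) : ℝ) : ℂ) * v i) := by
  rw [Lap, Matrix.sum_mulVec, Matrix.sum_mulVec, Finset.sum_apply, Finset.sum_apply, Finset.mul_sum,
    ← Finset.sum_add_distrib]
  refine Finset.sum_congr rfl fun ν _ => ?_
  rw [lapTerm_smulV]; ring

/-- **the pointwise majorant**: `|Δ(χ_yv)(i)| ≤ χ_y(i)|Δv(i)| + Σ_ν(|∇_νv(i−e_ν)| + |∇_νv(i)| + |v(i)|)` (by `|∇χ_y| ≤ η⁻¹·η`,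
`|∇∇χ_y| ≤ η⁻²·η²`). [cite: Balaban1984PropagatorsI, Prop. 1.2 (1.114) p.36 (ζ∇∇GJ); proof ours] -/
theorem norm_Lap_smulV_chi_le (hn : 1 ≤ n) (y : Tor M) (v : Tor (fine n M) × Fin d → ℂ) (i : Tor (fine n M) × Fin d) :
    ‖(Lap n M *ᵥ smulV n M (chi n M y) v) i‖
      ≤ chi n M y i.1 * ‖(Lap n M *ᵥ v) i‖
        + ∑ ν, (‖(fdiff (fine n M) (n : ℂ) ν *ᵥ v) (pb n M ν i)‖ + ‖(fdiff (fine n M) (n : ℂ) ν *ᵥ v) i‖ + ‖v i‖) := by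
  rw [Lap_smulV_eq]
  refine (norm_add_le _ _).trans (add_le_add ?_ ?_)
  · rw [norm_mul, Complex.norm_real, Real.norm_of_nonneg (chi_nonneg n M y i.1)]
  · refine (norm_sum_le _ _).trans (Finset.sum_le_sum fun ν _ => ?_)
    have hn0 : (0 : ℝ) < n := by exact_mod_cast hn
    -- the three coefficients are ≤ 1 in absolute value
    have ha : |(n : ℝ) * (chi n M y (nb n M ν i).1 - chi n M y i.1)| ≤ 1 := by
      have h := chi_diff_le n M hn y i.1 ν
      rw [abs_mul, Nat.abs_cast]
      calc (n : ℝ) * |chi n M y (nb n M ν i).1 - chi n M y i.1| ≤ n * (1 / n) :=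
            mul_le_mul_of_nonneg_left h hn0.le
        _ = 1 := by field_simp
    have hb : |(n : ℝ) * (chi n M y i.1 - chi n M y (pb n M ν i).1)| ≤ 1 := by
      have h := chi_diff_le n M hn y (pb n M ν i).1 ν
      have e : (pb n M ν i).1 + unitVec (fine n M) ν = i.1 := by simp [pb]
      rw [e] at h
      rw [abs_mul, Nat.abs_cast]
      calc (n : ℝ) * |chi n M y i.1 - chi n M y (pb n M ν i).1| ≤ n * (1 / n) := mul_le_mul_of_nonneg_left h hn0.le
        _ = 1 := by field_simp
    have hc : |(n : ℝ) ^ 2 * (2 * chi n M y i.1 - chi n M y (pb n M ν i).1 - chi n M y (nb n M ν i).1)| ≤ 1 := by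
      have h := chi_diff2_le n M hn y i.1 ν
      have e : i.1 - unitVec (fine n M) ν = (pb n M ν i).1 := rfl
      rw [e] at h
      rw [abs_mul, abs_of_nonneg (by positivity : (0 : ℝ) ≤ (n : ℝ) ^ 2)]
      have h' : |2 * chi n M y i.1 - chi n M y (pb n M ν i).1 - chi n M y (nb n M ν i).1| ≤ 1 / (n : ℝ) ^ 2 := by
        rw [abs_sub_comm] at h
        have : 2 * chi n M y i.1 - chi n M y (pb n M ν i).1 - chi n M y (nb n M ν i).1
            = 2 * chi n M y i.1 - (chi n M y (i.1 + unitVec (fine n M) ν) + chi n M y (pb n M ν i).1) := by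
          simp only [nb]; ring
        rw [this]; exact h
      calc (n : ℝ) ^ 2 * |2 * chi n M y i.1 - chi n M y (pb n M ν i).1 - chi n M y (nb n M ν i).1|
          ≤ (n : ℝ) ^ 2 * (1 / (n : ℝ) ^ 2) := mul_le_mul_of_nonneg_left h' (by positivity)
        _ = 1 := by field_simp
    set A := (fdiff (fine n M) (n : ℂ) ν *ᵥ v) (pb n M ν i)
    set B := (fdiff (fine n M) (n : ℂ) ν *ᵥ v) i
    refine (norm_add_le _ _).trans ?_
    refine (add_le_add (norm_sub_le _ _) le_rfl).trans ?_
    rw [norm_neg, norm_mul, norm_mul, norm_mul, Complex.norm_real, Complex.norm_real, Complex.norm_real,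
      Real.norm_eq_abs, Real.norm_eq_abs, Real.norm_eq_abs]
    have h1 : |(n : ℝ) * (chi n M y i.1 - chi n M y (pb n M ν i).1)| * ‖A‖ ≤ ‖A‖ := by
      calc _ ≤ 1 * ‖A‖ := mul_le_mul_of_nonneg_right hb (norm_nonneg _)
        _ = ‖A‖ := one_mul _
    have h2 : |(n : ℝ) * (chi n M y (nb n M ν i).1 - chi n M y i.1)| * ‖B‖ ≤ ‖B‖ := by
      calc _ ≤ 1 * ‖B‖ := mul_le_mul_of_nonneg_right ha (norm_nonneg _)
        _ = ‖B‖ := one_mul _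
    have h3 : |(n : ℝ) ^ 2 * (2 * chi n M y i.1 - chi n M y (pb n M ν i).1 - chi n M y (nb n M ν i).1)| * ‖v i‖ ≤ ‖v i‖ := by
      calc _ ≤ 1 * ‖v i‖ := mul_le_mul_of_nonneg_right hc (norm_nonneg _)
        _ = ‖v i‖ := one_mul _
    linarith

end Leibniz

/-! ## §5 Localisation: where `Δ(χ_yv)` lives, and the weight `e^{−δρ_{y₁}}` there -/

section Localise

variable (n : ℕ) [NeZero n] (M : Fin d → ℕ) [hM : ∀ μ, NeZero (M μ)]

/-- one fine step back: `|x − t| ≤ |(x − e_ν) − t| + 1`. [cite: Balaban1984PropagatorsI, (1.109) p.35 (|x − x′|)] -/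
theorem distU_le_pb (x t : Tor (fine n M)) (ν : Fin d) :
    distU n M x t ≤ distU n M (x - unitVec (fine n M) ν) t + 1 := by
  have h1 := distU_triangle n M x (x - unitVec (fine n M) ν) t
  have h2 : distU n M x (x - unitVec (fine n M) ν) ≤ 1 := by
    rw [distU_comm]
    have h := distU_step_le n M (x - unitVec (fine n M) ν) ν
    rw [sub_add_cancel] at h
    have hn : (1 : ℝ) ≤ n := by exact_mod_cast Nat.one_le_iff_ne_zero.mpr (NeZero.ne n)
    exact h.trans (by rw [div_le_one (by linarith)]; exact hn)
  linarith

/-- one fine step forth: `|x − t| ≤ |(x + e_ν) − t| + 1`. [cite: Balaban1984PropagatorsI, (1.109) p.35 (|x − x′|)] -/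
theorem distU_le_nb (x t : Tor (fine n M)) (ν : Fin d) :
    distU n M x t ≤ distU n M (x + unitVec (fine n M) ν) t + 1 := by
  have h1 := distU_triangle n M x (x + unitVec (fine n M) ν) t
  have h2 : distU n M x (x + unitVec (fine n M) ν) ≤ 1 := by
    have h := distU_step_le n M x ν
    have hn : (1 : ℝ) ≤ n := by exact_mod_cast Nat.one_le_iff_ne_zero.mpr (NeZero.ne n)
    exact h.trans (by rw [div_le_one (by linarith)]; exact hn)
  linarith

/-- … and `|(x + e_ν) − t| ≤ |x − t| + 1`. [cite: Balaban1984PropagatorsI, (1.109) p.35 (|x − x′|)] -/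
theorem distU_nb_le (x t : Tor (fine n M)) (ν : Fin d) :
    distU n M (x + unitVec (fine n M) ν) t ≤ distU n M x t + 1 := by
  have h := distU_le_pb n M (x + unitVec (fine n M) ν) t ν
  rwa [add_sub_cancel_right] at h

/-- **far from `n·y` nothing happens**: `Δ(χ_yv)(i) = 0` if `|i − n·y| > 9`. [cite: Balaban1984PropagatorsI, Prop. 1.2 (1.114) p.36 (ζ∇∇GJ); proof ours] -/
theorem Lap_smulV_chi_eq_zero (hn : 1 ≤ n) {y : Tor M} (v : Tor (fine n M) × Fin d → ℂ) {i : Tor (fine n M) × Fin d}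
    (hfar : 9 < distU n M i.1 (toFine n M y)) : (Lap n M *ᵥ smulV n M (chi n M y) v) i = 0 := by
  have hz : ∀ x : Tor (fine n M), 8 < distU n M x (toFine n M y) → chi n M y x = 0 := fun x hx => by
    by_contra h
    have := distU_le_of_chi_ne_zero n M hn h
    linarith
  have h0 : chi n M y i.1 = 0 := hz _ (by linarith)
  have hp : ∀ ν, chi n M y (pb n M ν i).1 = 0 := fun ν => hz _ (by
    have := distU_le_pb n M i.1 (toFine n M y) ν; simp only [pb]; linarith)
  have hq : ∀ ν, chi n M y (nb n M ν i).1 = 0 := fun ν => hz _ (by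
    have := distU_le_nb n M i.1 (toFine n M y) ν; simp only [nb]; linarith)
  rw [Lap_apply]
  refine Finset.sum_eq_zero fun ν _ => ?_
  simp only [smulV, h0, hp ν, hq ν, Complex.ofReal_zero, zero_mul, mul_zero, sub_zero]

/-- **the localised inverse weight**: within `11` units of `n·y`, `e^{−δρ_{y₁}} ≤ e^{13δ}e^{−δ|y−y₁|}` (`δ ≥ 0`).
[cite: Balaban1984PropagatorsI, Prop. 1.2 (1.114) p.36 (e^{−δ₀|y−y′|}); proof ours] -/
theorem wt_neg_le_near (hn : 1 ≤ n) {δ : ℝ} (hδ : 0 ≤ δ) (y₁ : Tor M) {y : Tor M} {x : Tor (fine n M)}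
    (hx : distU n M x (toFine n M y) ≤ 11) :
    wt n M (-δ) (rho n M y₁) x ≤ Real.exp (13 * δ) * Real.exp (-(δ * distSite M y y₁)) := by
  unfold wt
  rw [← Real.exp_add]
  apply Real.exp_le_exp.mpr
  have h1 := abs_rho_sub_rho_le n M y₁ x (toFine n M y)
  have h2 := distSite_sub_two_le_rho n M hn (toFine_mem_cubeT (n := n) (M := M) y) y₁
  have h3 := (abs_le.mp h1).1
  nlinarith

/-- the localisation indicator: `1` within `10` units of `n·y`, else `0`. [cite: Balaban1984PropagatorsI, Prop. 1.2 (1.114) p.36; construction ours] -/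
def ind (y : Tor M) (x : Tor (fine n M)) : ℝ := if distU n M x (toFine n M y) ≤ 10 then 1 else 0

omit [NeZero n] hM in
/-- `0 ≤ ind`. [cite: Balaban1984PropagatorsI, Prop. 1.2 (1.114) p.36; construction ours] -/
theorem ind_nonneg (y : Tor M) (x : Tor (fine n M)) : 0 ≤ ind n M y x := by
  unfold ind; split_ifs <;> norm_num

omit [NeZero n] hM in
/-- `ind² = ind`. [cite: Balaban1984PropagatorsI, Prop. 1.2 (1.114) p.36; construction ours] -/
theorem ind_sq (y : Tor M) (x : Tor (fine n M)) : ind n M y x ^ 2 = ind n M y x := by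
  unfold ind; split_ifs <;> norm_num

/-- **`|Δ(χ_yv)| ≤ ind·majorant`** everywhere. [cite: Balaban1984PropagatorsI, Prop. 1.2 (1.114) p.36 (ζ∇∇GJ); proof ours] -/
theorem norm_Lap_smulV_chi_le_ind (hn : 1 ≤ n) (y : Tor M) (v : Tor (fine n M) × Fin d → ℂ) (i : Tor (fine n M) × Fin d) :
    ‖(Lap n M *ᵥ smulV n M (chi n M y) v) i‖
      ≤ ind n M y i.1 * (‖(Lap n M *ᵥ v) i‖
        + ∑ ν, (‖(fdiff (fine n M) (n : ℂ) ν *ᵥ v) (pb n M ν i)‖ + ‖(fdiff (fine n M) (n : ℂ) ν *ᵥ v) i‖ + ‖v i‖)) := by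
  unfold ind
  split_ifs with h
  · rw [one_mul]
    refine (norm_Lap_smulV_chi_le n M hn y v i).trans (add_le_add ?_ le_rfl)
    calc chi n M y i.1 * ‖(Lap n M *ᵥ v) i‖ ≤ 1 * ‖(Lap n M *ᵥ v) i‖ :=
          mul_le_mul_of_nonneg_right (chi_le_one n M y i.1) (norm_nonneg _)
      _ = _ := one_mul _
  · rw [Lap_smulV_chi_eq_zero n M hn v (by linarith), norm_zero, zero_mul]

end Localise

/-! ## §6 The core: `Σ_{νν′} Σ_{Δ̃(y)} |∇_ν∇_{ν′}v|² ≤ C₄² e^{−2δ|y−y₁|}‖f‖²` for `Δ_a v = f`, `supp f ⊂ Δ̃(y₁)` -/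

section Core

variable (n : ℕ) [NeZero n] (M : Fin d → ℕ) [hM : ∀ μ, NeZero (M μ)]

/-- the localised `ℓ²` mass of `v` near `n·y`: `Σ ind·|v|² ≤ K²‖w‖²`, `w = e^{δρ_{y₁}}v`, `K = e^{13δ}e^{−δ|y−y₁|}`.
[cite: Balaban1984PropagatorsI, Prop. 1.2 (1.114) p.36; proof ours] -/
theorem sum_ind_nsq_le (hn : 1 ≤ n) {δ : ℝ} (hδ0 : 0 ≤ δ) (y₁ y : Tor M) (v : Tor (fine n M) × Fin d → ℂ) :
    ∑ i, ind n M y i.1 * ‖v i‖ ^ 2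
      ≤ (Real.exp (13 * δ) * Real.exp (-(δ * distSite M y y₁))) ^ 2 * nsq (wmul n M (wt n M δ (rho n M y₁)) v) := by
  unfold nsq
  rw [Finset.mul_sum]
  refine Finset.sum_le_sum fun i _ => ?_
  unfold ind
  split_ifs with h
  · rw [one_mul, norm_eq_wt_neg_mul n M δ (rho n M y₁) v i]
    have hw := wt_neg_le_near n M hn hδ0 y₁ (y := y) (x := i.1) (h.trans (by norm_num))
    have h0 := (wt_pos n M (-δ) (rho n M y₁) i.1).le
    calc (wt n M (-δ) (rho n M y₁) i.1 * ‖wmul n M (wt n M δ (rho n M y₁)) v i‖) ^ 2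
        = wt n M (-δ) (rho n M y₁) i.1 ^ 2 * ‖wmul n M (wt n M δ (rho n M y₁)) v i‖ ^ 2 := by ring
      _ ≤ _ := by gcongr
  · rw [zero_mul]; positivity

/-- near `n·y`, the product rule unweighted: `|∇_νv(i)| ≤ 2K(|∇_νw(i)| + |w(i)|)` if `i`, `i + e_ν` are within `11` units.
[cite: Balaban1984PropagatorsI, Prop. 1.2 (1.114) p.36, (1.121) p.37; proof ours] -/
theorem norm_fdiff_le_near (hn : 1 ≤ n) {δ : ℝ} (hδ0 : 0 ≤ δ) (hδ1 : δ ≤ 1) (y₁ : Tor M) {y : Tor M}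
    (v : Tor (fine n M) × Fin d → ℂ) (ν : Fin d) {i : Tor (fine n M) × Fin d}
    (hi : distU n M i.1 (toFine n M y) ≤ 11) (hi' : distU n M (nb n M ν i).1 (toFine n M y) ≤ 11) :
    ‖(fdiff (fine n M) (n : ℂ) ν *ᵥ v) i‖
      ≤ 2 * (Real.exp (13 * δ) * Real.exp (-(δ * distSite M y y₁))) *
        (‖(fdiff (fine n M) (n : ℂ) ν *ᵥ wmul n M (wt n M δ (rho n M y₁)) v) i‖
          + ‖wmul n M (wt n M δ (rho n M y₁)) v i‖) := by
  set w := wmul n M (wt n M δ (rho n M y₁)) v with hw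
  have hv : v = wmul n M (wt n M (-δ) (rho n M y₁)) w := by rw [hw, wmul_neg_wmul]
  have habs : |(-δ)| ≤ 1 := by rw [abs_neg, abs_of_nonneg hδ0]; exact hδ1
  have h1 := norm_fdiff_wmul_le n M (abs_rho_sub_rho_le n M y₁) habs w ν i
  rw [← hv] at h1
  refine h1.trans ?_
  have hE1 := wt_neg_le_near n M hn hδ0 y₁ hi'
  have hE0 := wt_neg_le_near n M hn hδ0 y₁ hi
  have hA := norm_nonneg ((fdiff (fine n M) (n : ℂ) ν *ᵥ w) i)
  have hB := norm_nonneg (w i)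
  have hK : 0 ≤ Real.exp (13 * δ) * Real.exp (-(δ * distSite M y y₁)) := by positivity
  have hW0 : 0 ≤ wt n M (-δ) (rho n M y₁) i.1 := (wt_pos n M (-δ) (rho n M y₁) i.1).le
  rw [abs_neg, abs_of_nonneg hδ0]
  calc wt n M (-δ) (rho n M y₁) (nb n M ν i).1 * ‖(fdiff (fine n M) (n : ℂ) ν *ᵥ w) i‖
        + 2 * δ * wt n M (-δ) (rho n M y₁) i.1 * ‖w i‖
      ≤ (Real.exp (13 * δ) * Real.exp (-(δ * distSite M y y₁))) * ‖(fdiff (fine n M) (n : ℂ) ν *ᵥ w) i‖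
        + 2 * 1 * (Real.exp (13 * δ) * Real.exp (-(δ * distSite M y y₁))) * ‖w i‖ := by gcongr
    _ ≤ _ := by nlinarith

/-- `Σ ind·|∇_νv|² ≤ 8K²(‖∇_νw‖² + ‖w‖²)`. [cite: Balaban1984PropagatorsI, Prop. 1.2 (1.114) p.36; proof ours] -/
theorem sum_ind_nsq_fdiff_le (hn : 1 ≤ n) {δ : ℝ} (hδ0 : 0 ≤ δ) (hδ1 : δ ≤ 1) (y₁ y : Tor M)
    (v : Tor (fine n M) × Fin d → ℂ) (ν : Fin d) :
    ∑ i, ind n M y i.1 * ‖(fdiff (fine n M) (n : ℂ) ν *ᵥ v) i‖ ^ 2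
      ≤ 8 * (Real.exp (13 * δ) * Real.exp (-(δ * distSite M y y₁))) ^ 2 *
        (nsq (fdiff (fine n M) (n : ℂ) ν *ᵥ wmul n M (wt n M δ (rho n M y₁)) v)
          + nsq (wmul n M (wt n M δ (rho n M y₁)) v)) := by
  set K := Real.exp (13 * δ) * Real.exp (-(δ * distSite M y y₁)) with hK
  set w := wmul n M (wt n M δ (rho n M y₁)) v with hw
  have hK0 : 0 ≤ K := by positivity
  unfold nsq
  rw [← Finset.sum_add_distrib, Finset.mul_sum]
  refine Finset.sum_le_sum fun i _ => ?_
  have hA := norm_nonneg ((fdiff (fine n M) (n : ℂ) ν *ᵥ w) i)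
  have hB := norm_nonneg (w i)
  unfold ind
  split_ifs with h
  · rw [one_mul]
    have hi : distU n M i.1 (toFine n M y) ≤ 11 := h.trans (by norm_num)
    have hi' : distU n M (nb n M ν i).1 (toFine n M y) ≤ 11 := by
      have := distU_nb_le n M i.1 (toFine n M y) ν; simp only [nb]; linarith
    have hp := norm_fdiff_le_near n M hn hδ0 hδ1 y₁ v ν hi hi'
    rw [← hK, ← hw] at hp
    have h0 := norm_nonneg ((fdiff (fine n M) (n : ℂ) ν *ᵥ v) i)
    calc ‖(fdiff (fine n M) (n : ℂ) ν *ᵥ v) i‖ ^ 2 ≤ (2 * K * (‖(fdiff (fine n M) (n : ℂ) ν *ᵥ w) i‖ + ‖w i‖)) ^ 2 :=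
          pow_le_pow_left₀ h0 hp 2
      _ ≤ 8 * K ^ 2 * (‖(fdiff (fine n M) (n : ℂ) ν *ᵥ w) i‖ ^ 2 + ‖w i‖ ^ 2) := by
          nlinarith [sq_nonneg (‖(fdiff (fine n M) (n : ℂ) ν *ᵥ w) i‖ - ‖w i‖), sq_nonneg K]
  · rw [zero_mul]; positivity

/-- `Σ_i ind(i)·|∇_νv(i − e_ν)|² ≤ 8K²(‖∇_νw‖² + ‖w‖²)` (re-indexed by the translation `i ↦ i − e_ν`).
[cite: Balaban1984PropagatorsI, Prop. 1.2 (1.114) p.36; proof ours] -/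
theorem sum_ind_nsq_fdiff_pb_le (hn : 1 ≤ n) {δ : ℝ} (hδ0 : 0 ≤ δ) (hδ1 : δ ≤ 1) (y₁ y : Tor M)
    (v : Tor (fine n M) × Fin d → ℂ) (ν : Fin d) :
    ∑ i, ind n M y i.1 * ‖(fdiff (fine n M) (n : ℂ) ν *ᵥ v) (pb n M ν i)‖ ^ 2
      ≤ 8 * (Real.exp (13 * δ) * Real.exp (-(δ * distSite M y y₁))) ^ 2 *
        (nsq (fdiff (fine n M) (n : ℂ) ν *ᵥ wmul n M (wt n M δ (rho n M y₁)) v)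
          + nsq (wmul n M (wt n M δ (rho n M y₁)) v)) := by
  set K := Real.exp (13 * δ) * Real.exp (-(δ * distSite M y y₁)) with hK
  set w := wmul n M (wt n M δ (rho n M y₁)) v with hw
  have hK0 : 0 ≤ K := by positivity
  -- re-index
  let e : Tor (fine n M) × Fin d ≃ Tor (fine n M) × Fin d :=
    (Equiv.subRight (unitVec (fine n M) ν)).prodCongr (Equiv.refl _)
  have hre : ∑ i, ind n M y i.1 * ‖(fdiff (fine n M) (n : ℂ) ν *ᵥ v) (pb n M ν i)‖ ^ 2
      = ∑ j, ind n M y (nb n M ν j).1 * ‖(fdiff (fine n M) (n : ℂ) ν *ᵥ v) j‖ ^ 2 := by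
    refine Fintype.sum_equiv e _ _ fun i => ?_
    have he : e i = pb n M ν i := rfl
    rw [he, nb_pb]
  rw [hre]
  unfold nsq
  rw [← Finset.sum_add_distrib, Finset.mul_sum]
  refine Finset.sum_le_sum fun i _ => ?_
  have hA := norm_nonneg ((fdiff (fine n M) (n : ℂ) ν *ᵥ w) i)
  have hB := norm_nonneg (w i)
  unfold ind
  split_ifs with h
  · rw [one_mul]
    have hi' : distU n M (nb n M ν i).1 (toFine n M y) ≤ 11 := h.trans (by norm_num)
    have hi : distU n M i.1 (toFine n M y) ≤ 11 := by
      have := distU_le_nb n M i.1 (toFine n M y) ν; simp only [nb] at h; linarith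
    have hp := norm_fdiff_le_near n M hn hδ0 hδ1 y₁ v ν hi hi'
    rw [← hK, ← hw] at hp
    have h0 := norm_nonneg ((fdiff (fine n M) (n : ℂ) ν *ᵥ v) i)
    calc ‖(fdiff (fine n M) (n : ℂ) ν *ᵥ v) i‖ ^ 2 ≤ (2 * K * (‖(fdiff (fine n M) (n : ℂ) ν *ᵥ w) i‖ + ‖w i‖)) ^ 2 :=
          pow_le_pow_left₀ h0 hp 2
      _ ≤ 8 * K ^ 2 * (‖(fdiff (fine n M) (n : ℂ) ν *ᵥ w) i‖ ^ 2 + ‖w i‖ ^ 2) := by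
          nlinarith [sq_nonneg (‖(fdiff (fine n M) (n : ℂ) ν *ᵥ w) i‖ - ‖w i‖), sq_nonneg K]
  · rw [zero_mul]; positivity

/-- `Δv = f + ∂P∂*v − aQ*Qv` when `Δ_a v = f`. [cite: Balaban1984PropagatorsI, (1.69) p.30 (Δ_a = Δ − ∂P∂* + aQ*Q)] -/
theorem Lap_mulVec_eq_of_solve {a : ℝ} {f v : Tor (fine n M) × Fin d → ℂ} (hv : DeltaA n M a *ᵥ v = f) :
    Lap n M *ᵥ v = f + (dPd n M *ᵥ v - (a : ℂ) • ((QvAdj n M * QvOp n M) *ᵥ v)) := by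
  have h := hv
  rw [DeltaA_eq, Matrix.add_mulVec, Matrix.sub_mulVec, Matrix.smul_mulVec] at h
  rw [← h]; abel

/-- the localised `ℓ²` mass of `Δv` near `n·y`: `Σ ind·|Δv|² ≤ 3K²(e^{2δ}‖f‖² + (‖E∂P∂*E⁻¹‖² + a²‖EQ*QE⁻¹‖²)‖w‖²)`.
[cite: Balaban1984PropagatorsI, Prop. 1.2 (1.114) p.36, (1.126) p.38; proof ours] -/
theorem sum_ind_nsq_Lap_le (hn : 1 ≤ n) {a : ℝ} (ha : 0 < a) {δ' C : ℝ} (hδ' : 0 < δ') (hC : 0 ≤ C)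
    (h126 : ∀ i j, ‖dPd n M i j‖ ≤ C * ((n : ℝ) ^ d)⁻¹ * Real.exp (-(δ' * distU n M i.1 j.1)))
    {δ : ℝ} (hδ0 : 0 ≤ δ) (hδ2 : δ ≤ δ' / 2) {y₁ : Tor M} (y : Tor M) {f v : Tor (fine n M) × Fin d → ℂ}
    (hf : ∀ i, f i ≠ 0 → i.1 ∈ cubeT n M y₁) (hv : DeltaA n M a *ᵥ v = f) :
    ∑ i, ind n M y i.1 * ‖(Lap n M *ᵥ v) i‖ ^ 2
      ≤ 3 * (Real.exp (13 * δ) * Real.exp (-(δ * distSite M y y₁))) ^ 2 *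
        (Real.exp (2 * δ) * nsq f
          + ((normK d δ' C + δ * cK d δ' C) ^ 2 + a ^ 2 * Real.exp (8 * δ)) * nsq (wmul n M (wt n M δ (rho n M y₁)) v)) := by
  set K := Real.exp (13 * δ) * Real.exp (-(δ * distSite M y y₁)) with hK
  set E := wt n M δ (rho n M y₁) with hE
  set w := wmul n M E v with hw
  have hK0 : 0 ≤ K := by positivity
  have hvw : v = wmul n M (wt n M (-δ) (rho n M y₁)) w := by rw [hw, hE, wmul_neg_wmul]
  have hL := Lap_mulVec_eq_of_solve n M hv
  set X := wmul n M E (dPd n M *ᵥ v) with hX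
  set Y := wmul n M E ((QvAdj n M * QvOp n M) *ᵥ v) with hY
  -- the norms of the conjugated operators
  have habs : |δ| ≤ δ' / 2 := by rw [abs_of_nonneg hδ0]; exact hδ2
  have hXn : nsq X ≤ (normK d δ' C + δ * cK d δ' C) ^ 2 * nsq w := by
    have h := l2_conjDPD_le n M hn (abs_rho_sub_rho_le n M y₁) hδ' hC habs h126 w
    rw [← hvw, ← hE, ← hX, abs_of_nonneg hδ0] at h
    have h0 : 0 ≤ (normK d δ' C + δ * cK d δ' C) :=
      add_nonneg (normK_nonneg (d := d) hδ' hC) (mul_nonneg hδ0 (cK_nonneg (d := d) hδ' hC))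
    calc nsq X = B5Prop11Lattice.l2 X ^ 2 := (l2_sq X).symm
      _ ≤ ((normK d δ' C + δ * cK d δ' C) * B5Prop11Lattice.l2 w) ^ 2 := pow_le_pow_left₀ (l2_nonneg _) h 2
      _ = _ := by rw [mul_pow, l2_sq]
  have hYn : nsq Y ≤ Real.exp (8 * δ) * nsq w := by
    have h := l2_conjQQ_le n M (abs_rho_sub_rho_le n M y₁) δ w
    rw [← hvw, ← hE, ← hY, abs_of_nonneg hδ0] at h
    calc nsq Y = B5Prop11Lattice.l2 Y ^ 2 := (l2_sq Y).symm
      _ ≤ (Real.exp (4 * δ) * B5Prop11Lattice.l2 w) ^ 2 := pow_le_pow_left₀ (l2_nonneg _) h 2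
      _ = _ := by rw [mul_pow, l2_sq, ← Real.exp_nat_mul]; ring_nf
  -- pointwise
  have hpt : ∀ i, ind n M y i.1 * ‖(Lap n M *ᵥ v) i‖ ^ 2
      ≤ 3 * K ^ 2 * (Real.exp (2 * δ) * ‖f i‖ ^ 2 + ‖X i‖ ^ 2 + a ^ 2 * ‖Y i‖ ^ 2) := by
    intro i
    unfold ind
    split_ifs with h
    · rw [one_mul]
      have hi : distU n M i.1 (toFine n M y) ≤ 11 := h.trans (by norm_num)
      have hEi := wt_neg_le_near n M hn hδ0 y₁ hi
      rw [← hK] at hEi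
      have hW0 : 0 ≤ wt n M (-δ) (rho n M y₁) i.1 := (wt_pos n M (-δ) (rho n M y₁) i.1).le
      -- the three terms
      have hf' : ‖f i‖ ≤ K * (Real.exp δ * ‖f i‖) := by
        by_cases h0 : f i = 0
        · simp [h0]
        · have hc := hf i h0
          have h1 : wt n M (-δ) (rho n M y₁) i.1 * wt n M δ (rho n M y₁) i.1 = 1 := by
            rw [wt_neg, inv_mul_cancel₀ (wt_pos n M δ (rho n M y₁) i.1).ne']
          have h2 := wt_le_of_mem_cubeT n M hδ0 hc
          calc ‖f i‖ = (wt n M (-δ) (rho n M y₁) i.1 * wt n M δ (rho n M y₁) i.1) * ‖f i‖ := by rw [h1, one_mul]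
            _ ≤ (K * Real.exp δ) * ‖f i‖ := by
                refine mul_le_mul_of_nonneg_right ?_ (norm_nonneg _)
                exact mul_le_mul hEi h2 (wt_pos n M δ (rho n M y₁) i.1).le hK0
            _ = _ := by ring
      have hd' : ‖(dPd n M *ᵥ v) i‖ ≤ K * ‖X i‖ := by
        rw [norm_eq_wt_neg_mul n M δ (rho n M y₁) (dPd n M *ᵥ v) i, ← hE, ← hX]
        exact mul_le_mul_of_nonneg_right hEi (norm_nonneg _)
      have hq' : ‖((QvAdj n M * QvOp n M) *ᵥ v) i‖ ≤ K * ‖Y i‖ := by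
        rw [norm_eq_wt_neg_mul n M δ (rho n M y₁) ((QvAdj n M * QvOp n M) *ᵥ v) i, ← hE, ← hY]
        exact mul_le_mul_of_nonneg_right hEi (norm_nonneg _)
      have hsum : ‖(Lap n M *ᵥ v) i‖ ≤ K * (Real.exp δ * ‖f i‖ + ‖X i‖ + a * ‖Y i‖) := by
        rw [hL, Pi.add_apply, Pi.sub_apply, Pi.smul_apply, smul_eq_mul]
        refine (norm_add_le _ _).trans ?_
        refine (add_le_add le_rfl (norm_sub_le _ _)).trans ?_
        rw [norm_mul, Complex.norm_real, Real.norm_of_nonneg ha.le]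
        have := mul_le_mul_of_nonneg_left hq' ha.le
        nlinarith
      have h0 := norm_nonneg ((Lap n M *ᵥ v) i)
      calc ‖(Lap n M *ᵥ v) i‖ ^ 2 ≤ (K * (Real.exp δ * ‖f i‖ + ‖X i‖ + a * ‖Y i‖)) ^ 2 := pow_le_pow_left₀ h0 hsum 2
        _ ≤ 3 * K ^ 2 * (Real.exp (2 * δ) * ‖f i‖ ^ 2 + ‖X i‖ ^ 2 + a ^ 2 * ‖Y i‖ ^ 2) := by
            have e2 : Real.exp (2 * δ) = Real.exp δ ^ 2 := by rw [← Real.exp_nat_mul]; ring_nf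
            rw [e2]
            nlinarith [sq_nonneg (Real.exp δ * ‖f i‖ - ‖X i‖), sq_nonneg (Real.exp δ * ‖f i‖ - a * ‖Y i‖),
              sq_nonneg (‖X i‖ - a * ‖Y i‖), sq_nonneg K]
    · rw [zero_mul]; positivity
  refine (Finset.sum_le_sum fun i _ => hpt i).trans ?_
  rw [← Finset.mul_sum, Finset.sum_add_distrib, Finset.sum_add_distrib, ← Finset.mul_sum, ← Finset.mul_sum]
  change 3 * K ^ 2 * (Real.exp (2 * δ) * nsq f + nsq X + a ^ 2 * nsq Y) ≤ _
  have h3K : 0 ≤ 3 * K ^ 2 := by positivity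
  refine mul_le_mul_of_nonneg_left ?_ h3K
  have hY' := mul_le_mul_of_nonneg_left hYn (sq_nonneg a)
  have e : ((normK d δ' C + δ * cK d δ' C) ^ 2 + a ^ 2 * Real.exp (8 * δ)) * nsq w
      = (normK d δ' C + δ * cK d δ' C) ^ 2 * nsq w + a ^ 2 * (Real.exp (8 * δ) * nsq w) := by ring
  rw [e]
  linarith

/-- `∇_ν∇_{ν′}v = ∇_ν∇_{ν′}(χ_yv)` on the bonds over `Δ̃(y)` (`χ_y = 1` two fine steps around `Δ̃(y)`).
[cite: Balaban1984PropagatorsI, Prop. 1.2 (1.114) p.36 (supp ζ ⊂ Δ̃(y)); proof ours] -/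
theorem grad2_smulV_chi_eq (hn : 1 ≤ n) {y : Tor M} (v : Tor (fine n M) × Fin d → ℂ) (p : Fin d × Fin d)
    {i : Tor (fine n M) × Fin d} (hi : i.1 ∈ cubeT n M y) :
    grad2 n M (smulV n M (chi n M y) v) p i = grad2 n M v p i := by
  obtain ⟨h0, h1, h12⟩ := chi_eq_one_near_cube n M hn hi p.1 p.2
  obtain ⟨-, h2, -⟩ := chi_eq_one_near_cube n M hn hi p.2 p.1
  simp only [grad2, fdiff_apply, smulV, nb]
  rw [h0, h1, h2, h12]
  push_cast
  ring

/-- the second-order constant `C₄²` (ours). [cite: Balaban1984PropagatorsI, Prop. 1.2 (1.114) p.36 (the constant O(1)); value ours] -/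
def C4sq (d : ℕ) (a δ' C δ : ℝ) : ℝ :=
  Real.exp (26 * δ) * (6 * Real.exp (2 * δ)
    + (6 * ((normK d δ' C + δ * cK d δ' C) ^ 2 + a ^ 2 * Real.exp (8 * δ)) + 96 * d + 102 * (d : ℝ) ^ 2)
      * (2 * Real.exp δ / gammaZero d a) ^ 2)

omit [NeZero n] hM in
/-- `0 ≤ C₄²`. [cite: Balaban1984PropagatorsI, Prop. 1.2 (1.114) p.36; value ours] -/
theorem C4sq_nonneg (d : ℕ) (a δ' C δ : ℝ) : 0 ≤ C4sq d a δ' C δ := by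
  unfold C4sq; positivity

/-- **THE CORE OF THE SECOND-ORDER ENTRIES**: if `Δ_a v = f` with `supp f ⊂ Δ̃(y₁) × dirs` then
`Σ_{νν′} Σ_{(x,μ): x∈Δ̃(y)} |(∇_ν∇_{ν′}v)_μ(x)|² ≤ C₄²·e^{−2δ|y−y₁|}·‖f‖²` for `0 ≤ δ ≤ δ₁`, UNDER (1.126) — via the
localisation `χ_y`, `Σ‖∇_ν∇_{ν′}(χ_yv)‖² = ‖Δ(χ_yv)‖²`, the Leibniz majorant, `Δv = f + ∂P∂*v − aQ*Qv` and the weighted solve.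
[cite: Balaban1984PropagatorsI, Prop. 1.2 (1.114) p.36 (ζ∇∇GJ), Prop. 1.1 (1.89) p.33, p.39; proof ours by the p.36 route] -/
theorem sum_cube_grad2_le (hn : 1 ≤ n) {a : ℝ} (ha : 0 < a) {δ' C : ℝ} (hδ' : 0 < δ') (hC : 0 ≤ C)
    (h126 : ∀ i j, ‖dPd n M i j‖ ≤ C * ((n : ℝ) ^ d)⁻¹ * Real.exp (-(δ' * distU n M i.1 j.1)))
    {δ : ℝ} (hδ0 : 0 ≤ δ) (hδ : δ ≤ delta1 d a δ' C) {y₁ : Tor M} (y : Tor M) {f v : Tor (fine n M) × Fin d → ℂ}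
    (hf : ∀ i, f i ≠ 0 → i.1 ∈ cubeT n M y₁) (hv : DeltaA n M a *ᵥ v = f) :
    ∑ p : Fin d × Fin d, ∑ i, (if i.1 ∈ cubeT n M y then ‖grad2 n M v p i‖ ^ 2 else 0)
      ≤ C4sq d a δ' C δ * Real.exp (-(2 * (δ * distSite M y y₁))) * nsq f := by
  obtain ⟨hδ1, hδ2, -⟩ := delta1_spec (d := d) ha hδ' hC hδ
  set K := Real.exp (13 * δ) * Real.exp (-(δ * distSite M y y₁)) with hK
  set E := wt n M δ (rho n M y₁) with hE
  set w := wmul n M E v with hw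
  have hK0 : 0 ≤ K := by positivity
  have hS := solve_bound n M hn ha hδ' hC h126 hδ0 hδ hf hv
  rw [← hE, ← hw] at hS
  set χv := smulV n M (chi n M y) v with hχv
  -- Step 1: the cube sum is dominated by ‖Δ(χ_y v)‖²
  have h1 : ∑ p : Fin d × Fin d, ∑ i, (if i.1 ∈ cubeT n M y then ‖grad2 n M v p i‖ ^ 2 else 0)
      ≤ nsq (Lap n M *ᵥ χv) := by
    rw [← sum_nsq_fdiff_fdiff n M χv]
    refine Finset.sum_le_sum fun p _ => ?_
    unfold nsq
    refine Finset.sum_le_sum fun i _ => ?_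
    split_ifs with hi
    · rw [← grad2_smulV_chi_eq n M hn v p hi]; rfl
    · positivity
  -- Step 2: the pointwise majorant, squared (with the indicator distributed into each term)
  have h2 : ∀ i, ‖(Lap n M *ᵥ χv) i‖ ^ 2 ≤ 2 * (ind n M y i.1 * ‖(Lap n M *ᵥ v) i‖ ^ 2)
      + 6 * d * ∑ ν, (ind n M y i.1 * ‖(fdiff (fine n M) (n : ℂ) ν *ᵥ v) (pb n M ν i)‖ ^ 2
        + ind n M y i.1 * ‖(fdiff (fine n M) (n : ℂ) ν *ᵥ v) i‖ ^ 2 + ind n M y i.1 * ‖v i‖ ^ 2) := by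
    intro i
    have hm := norm_Lap_smulV_chi_le_ind n M hn y v i
    set A := ‖(Lap n M *ᵥ v) i‖ with hA
    set T : Fin d → ℝ := fun ν => ‖(fdiff (fine n M) (n : ℂ) ν *ᵥ v) (pb n M ν i)‖
      + ‖(fdiff (fine n M) (n : ℂ) ν *ᵥ v) i‖ + ‖v i‖ with hT
    have hT0 : 0 ≤ ∑ ν, T ν := Finset.sum_nonneg fun ν _ => by positivity
    have hA0 : 0 ≤ A := norm_nonneg _
    have hCS : (∑ ν, T ν) ^ 2 ≤ d * ∑ ν, T ν ^ 2 := by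
      have := sq_sum_le_card_mul_sum_sq (s := Finset.univ) (f := T)
      rwa [Finset.card_univ, Fintype.card_fin] at this
    have hT3 : ∀ ν, T ν ^ 2 ≤ 3 * (‖(fdiff (fine n M) (n : ℂ) ν *ᵥ v) (pb n M ν i)‖ ^ 2
        + ‖(fdiff (fine n M) (n : ℂ) ν *ᵥ v) i‖ ^ 2 + ‖v i‖ ^ 2) := by
      intro ν
      simp only [hT]
      nlinarith [sq_nonneg (‖(fdiff (fine n M) (n : ℂ) ν *ᵥ v) (pb n M ν i)‖ - ‖(fdiff (fine n M) (n : ℂ) ν *ᵥ v) i‖),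
        sq_nonneg (‖(fdiff (fine n M) (n : ℂ) ν *ᵥ v) (pb n M ν i)‖ - ‖v i‖),
        sq_nonneg (‖(fdiff (fine n M) (n : ℂ) ν *ᵥ v) i‖ - ‖v i‖)]
    have hT3s : ∑ ν, T ν ^ 2 ≤ 3 * ∑ ν, (‖(fdiff (fine n M) (n : ℂ) ν *ᵥ v) (pb n M ν i)‖ ^ 2
        + ‖(fdiff (fine n M) (n : ℂ) ν *ᵥ v) i‖ ^ 2 + ‖v i‖ ^ 2) := by
      rw [Finset.mul_sum]; exact Finset.sum_le_sum fun ν _ => hT3 ν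
    have hd : (0 : ℝ) ≤ d := Nat.cast_nonneg d
    unfold ind at hm ⊢
    split_ifs at hm ⊢ with h
    · rw [one_mul] at hm
      simp only [one_mul]
      have hsq : ‖(Lap n M *ᵥ χv) i‖ ^ 2 ≤ (A + ∑ ν, T ν) ^ 2 := pow_le_pow_left₀ (norm_nonneg _) hm 2
      have hdT := mul_le_mul_of_nonneg_left hT3s hd
      nlinarith [sq_nonneg (A - ∑ ν, T ν)]
    · rw [zero_mul] at hm
      have h0 : ‖(Lap n M *ᵥ χv) i‖ = 0 := le_antisymm hm (norm_nonneg _)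
      rw [h0]
      simp only [zero_mul, add_zero, Finset.sum_const_zero, mul_zero]
      norm_num
  -- Step 3: sum the majorant
  set F := nsq f with hF
  set W := nsq w with hW
  set G : Fin d → ℝ := fun ν => nsq (fdiff (fine n M) (n : ℂ) ν *ᵥ w) with hG
  have hF0 : 0 ≤ F := nsq_nonneg f
  have hW0 : 0 ≤ W := nsq_nonneg w
  have hG0 : ∀ ν, 0 ≤ G ν := fun ν => nsq_nonneg _
  have hPL := sum_ind_nsq_Lap_le n M hn ha hδ' hC h126 hδ0 hδ2 y hf hv
  have hPv := sum_ind_nsq_le n M hn hδ0 y₁ y v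
  have hP1 := fun ν => sum_ind_nsq_fdiff_le n M hn hδ0 hδ1 y₁ y v ν
  have hP2 := fun ν => sum_ind_nsq_fdiff_pb_le n M hn hδ0 hδ1 y₁ y v ν
  rw [← hK, ← hE, ← hw] at hPL hPv hP1 hP2
  simp only [← hF, ← hW] at hPL hPv hP1 hP2
  have hs1 : ∑ i, (2 * (ind n M y i.1 * ‖(Lap n M *ᵥ v) i‖ ^ 2)
      + 6 * d * ∑ ν, (ind n M y i.1 * ‖(fdiff (fine n M) (n : ℂ) ν *ᵥ v) (pb n M ν i)‖ ^ 2
        + ind n M y i.1 * ‖(fdiff (fine n M) (n : ℂ) ν *ᵥ v) i‖ ^ 2 + ind n M y i.1 * ‖v i‖ ^ 2))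
      = 2 * ∑ i, ind n M y i.1 * ‖(Lap n M *ᵥ v) i‖ ^ 2
        + 6 * d * ∑ ν, (∑ i, ind n M y i.1 * ‖(fdiff (fine n M) (n : ℂ) ν *ᵥ v) (pb n M ν i)‖ ^ 2
          + ∑ i, ind n M y i.1 * ‖(fdiff (fine n M) (n : ℂ) ν *ᵥ v) i‖ ^ 2 + ∑ i, ind n M y i.1 * ‖v i‖ ^ 2) := by
    rw [Finset.sum_add_distrib, ← Finset.mul_sum, ← Finset.mul_sum, Finset.sum_comm]
    congr 2
    refine Finset.sum_congr rfl fun ν _ => ?_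
    rw [Finset.sum_add_distrib, Finset.sum_add_distrib]
  have h3 : nsq (Lap n M *ᵥ χv) ≤ 2 * (3 * K ^ 2 * (Real.exp (2 * δ) * F
      + ((normK d δ' C + δ * cK d δ' C) ^ 2 + a ^ 2 * Real.exp (8 * δ)) * W))
      + 6 * d * ∑ ν, (8 * K ^ 2 * (G ν + W) + 8 * K ^ 2 * (G ν + W) + K ^ 2 * W) := by
    unfold nsq
    refine (Finset.sum_le_sum fun i _ => h2 i).trans ?_
    rw [hs1]
    refine add_le_add (mul_le_mul_of_nonneg_left hPL (by norm_num)) ?_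
    refine mul_le_mul_of_nonneg_left (Finset.sum_le_sum fun ν _ => ?_) (by positivity)
    exact add_le_add (add_le_add (hP2 ν) (hP1 ν)) hPv
  -- Step 4: arithmetic
  have hsumG : ∑ ν, G ν + W ≤ (2 * Real.exp δ / gammaZero d a) ^ 2 * F := hS
  have hGs0 : 0 ≤ ∑ ν, G ν := Finset.sum_nonneg fun ν _ => hG0 ν
  have hsum2 : ∑ ν, (8 * K ^ 2 * (G ν + W) + 8 * K ^ 2 * (G ν + W) + K ^ 2 * W)
      = 16 * K ^ 2 * ∑ ν, G ν + 17 * d * (K ^ 2 * W) := by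
    have e : ∀ ν, 8 * K ^ 2 * (G ν + W) + 8 * K ^ 2 * (G ν + W) + K ^ 2 * W = 16 * K ^ 2 * G ν + 17 * (K ^ 2 * W) :=
      fun ν => by ring
    simp only [e]
    rw [Finset.sum_add_distrib, ← Finset.mul_sum, Finset.sum_const, Finset.card_univ, Fintype.card_fin, nsmul_eq_mul]
    ring
  rw [hsum2] at h3
  have hK2 : K ^ 2 = Real.exp (26 * δ) * Real.exp (-(2 * (δ * distSite M y y₁))) := by
    rw [hK, mul_pow, ← Real.exp_nat_mul, ← Real.exp_nat_mul]; ring_nf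
  have hd : (0 : ℝ) ≤ d := Nat.cast_nonneg d
  set nK := (normK d δ' C + δ * cK d δ' C) ^ 2 + a ^ 2 * Real.exp (8 * δ) with hnK
  have hnK0 : 0 ≤ nK := by positivity
  set Cs := (2 * Real.exp δ / gammaZero d a) ^ 2 with hCs
  have hcoef : 0 ≤ 6 * nK + 96 * d + 102 * (d : ℝ) ^ 2 := by positivity
  have hK2n : 0 ≤ K ^ 2 := sq_nonneg K
  -- total ≤ K²[6e^{2δ}F + (6 nK + 96 d + 102 d²)(ΣG + W)] ≤ K²[6e^{2δ} + (…)Cs] F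
  have eL : 2 * (3 * K ^ 2 * (Real.exp (2 * δ) * F + nK * W)) + 6 * d * (16 * K ^ 2 * ∑ ν, G ν + 17 * d * (K ^ 2 * W))
      = K ^ 2 * (6 * Real.exp (2 * δ) * F + 6 * nK * W + 96 * d * ∑ ν, G ν + 102 * (d : ℝ) ^ 2 * W) := by ring
  have eR : K ^ 2 * (6 * Real.exp (2 * δ) * F + (6 * nK + 96 * d + 102 * (d : ℝ) ^ 2) * (∑ ν, G ν + W))
      = K ^ 2 * (6 * Real.exp (2 * δ) * F + 6 * nK * W + 96 * d * ∑ ν, G ν + 102 * (d : ℝ) ^ 2 * W)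
        + K ^ 2 * (6 * nK * ∑ ν, G ν + 96 * d * W + 102 * (d : ℝ) ^ 2 * ∑ ν, G ν) := by ring
  have hpos : 0 ≤ K ^ 2 * (6 * nK * ∑ ν, G ν + 96 * d * W + 102 * (d : ℝ) ^ 2 * ∑ ν, G ν) := by
    refine mul_nonneg hK2n (add_nonneg (add_nonneg ?_ ?_) ?_)
    · exact mul_nonneg (by positivity) hGs0
    · exact mul_nonneg (by positivity) hW0
    · exact mul_nonneg (by positivity) hGs0
  have h4 : 2 * (3 * K ^ 2 * (Real.exp (2 * δ) * F + nK * W)) + 6 * d * (16 * K ^ 2 * ∑ ν, G ν + 17 * d * (K ^ 2 * W))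
      ≤ K ^ 2 * (6 * Real.exp (2 * δ) * F + (6 * nK + 96 * d + 102 * (d : ℝ) ^ 2) * (∑ ν, G ν + W)) := by
    rw [eR, eL]; linarith
  have h5 : K ^ 2 * (6 * Real.exp (2 * δ) * F + (6 * nK + 96 * d + 102 * (d : ℝ) ^ 2) * (∑ ν, G ν + W))
      ≤ K ^ 2 * (6 * Real.exp (2 * δ) * F + (6 * nK + 96 * d + 102 * (d : ℝ) ^ 2) * (Cs * F)) := by
    have := mul_le_mul_of_nonneg_left hsumG hcoef
    exact mul_le_mul_of_nonneg_left (by linarith) hK2n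
  have h6 : K ^ 2 * (6 * Real.exp (2 * δ) * F + (6 * nK + 96 * d + 102 * (d : ℝ) ^ 2) * (Cs * F))
      = C4sq d a δ' C δ * Real.exp (-(2 * (δ * distSite M y y₁))) * F := by
    rw [hK2, C4sq, ← hnK, ← hCs]; ring
  linarith [h1, h3, h4, h5, h6.le]

end Core

/-! ## §7 The entries m = 4 (`‖ζ∇∇GJ‖`) and m = 5 (`‖ζG∇*∇*J‖`, by duality) -/

section Entries

variable (n : ℕ) [NeZero n] (M : Fin d → ℕ) [hM : ∀ μ, NeZero (M μ)]

/-- **(1.114), ENTRY `‖ζ∇∇GJ‖`** for `G = Δ_a⁻¹` on the lattice torus of record, UNDER (1.126):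
`‖ζ∇∇GJ‖ ≤ C₄·e^{−δ|y−y′|}·|ζ|·‖J‖` for `supp ζ ⊂ Δ̃(y)`, `supp J ⊂ Δ̃(y′)`, `0 ≤ δ ≤ δ₁`.
[cite: Balaban1984PropagatorsI, Prop. 1.2 (1.114) p.36, p.39; proof ours by the p.36 route] -/
theorem l2T_smulT_grad2G_le (hn : 1 ≤ n) {a : ℝ} (ha : 0 < a) {δ' C : ℝ} (hδ' : 0 < δ') (hC : 0 ≤ C)
    (h126 : ∀ i j, ‖dPd n M i j‖ ≤ C * ((n : ℝ) ^ d)⁻¹ * Real.exp (-(δ' * distU n M i.1 j.1)))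
    {δ : ℝ} (hδ0 : 0 ≤ δ) (hδ : δ ≤ delta1 d a δ' C) {ζ : Tor (fine n M) → ℝ} {y y' : Tor M} (hζ : cutInL n M ζ y)
    {J : Tor (fine n M) × Fin d → ℂ} (hJ : ∀ i, J i ≠ 0 → i.1 ∈ cubeT n M y') :
    l2T (smulT n M ζ (grad2 n M ((DeltaA n M a)⁻¹ *ᵥ J)))
      ≤ Real.sqrt (C4sq d a δ' C δ) * Real.exp (-(δ * distSite M y y')) * cutSupL n M ζ * l2 J := by
  set v := (DeltaA n M a)⁻¹ *ᵥ J with hv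
  have hcore := sum_cube_grad2_le n M hn ha hδ' hC h126 hδ0 hδ y hJ (DeltaA_mulVec_G n M hn ha J)
  rw [← hv] at hcore
  have hζ0 : 0 ≤ cutSupL n M ζ := cutSupL_nonneg ζ
  have hsq : l2T (smulT n M ζ (grad2 n M v)) ^ 2
      ≤ cutSupL n M ζ ^ 2 * ∑ p : Fin d × Fin d, ∑ i, (if i.1 ∈ cubeT n M y then ‖grad2 n M v p i‖ ^ 2 else 0) := by
    rw [l2T_sq, Finset.mul_sum]
    refine Finset.sum_le_sum fun p _ => ?_
    rw [smulT_apply]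
    have h := nsq_smulV_le_of_majorant n M hζ (grad2 n M v p)
      (fun i => if i.1 ∈ cubeT n M y then ‖grad2 n M v p i‖ else 0)
      (fun i => by
        show 0 ≤ (if i.1 ∈ cubeT n M y then ‖grad2 n M v p i‖ else 0)
        split_ifs <;> positivity)
      (fun i hi => by
        show ‖grad2 n M v p i‖ ≤ (if i.1 ∈ cubeT n M y then ‖grad2 n M v p i‖ else 0)
        rw [if_pos hi])
    refine h.trans (le_of_eq ?_)
    congr 1
    refine Finset.sum_congr rfl fun i _ => ?_
    split_ifs <;> simp
  have h2 : l2T (smulT n M ζ (grad2 n M v)) ^ 2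
      ≤ (Real.sqrt (C4sq d a δ' C δ) * Real.exp (-(δ * distSite M y y')) * cutSupL n M ζ) ^ 2 * nsq J := by
    have e : (Real.sqrt (C4sq d a δ' C δ) * Real.exp (-(δ * distSite M y y')) * cutSupL n M ζ) ^ 2 * nsq J
        = cutSupL n M ζ ^ 2 * (C4sq d a δ' C δ * Real.exp (-(2 * (δ * distSite M y y'))) * nsq J) := by
      rw [mul_pow, mul_pow, Real.sq_sqrt (C4sq_nonneg d a δ' C δ), ← Real.exp_nat_mul]; ring_nf
    rw [e]
    exact hsq.trans (mul_le_mul_of_nonneg_left hcore (sq_nonneg _))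
  have h3 := Real.sqrt_le_sqrt h2
  have hnn : 0 ≤ Real.sqrt (C4sq d a δ' C δ) * Real.exp (-(δ * distSite M y y')) * cutSupL n M ζ :=
    mul_nonneg (mul_nonneg (Real.sqrt_nonneg _) (Real.exp_pos _).le) hζ0
  rw [Real.sqrt_sq (l2T_nonneg _), Real.sqrt_mul (sq_nonneg _), Real.sqrt_sq hnn] at h3
  exact h3

omit [NeZero n] hM in
/-- `smulV` is the multiplication operator `wmul` of `B5CombesThomasLattice`. [cite: Balaban1984PropagatorsI, Prop. 1.2 (1.111) p.35 (ζ·)] -/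
theorem smulV_eq_wmul (ζ : Tor (fine n M) → ℝ) (A : Tor (fine n M) × Fin d → ℂ) : smulV n M ζ A = wmul n M ζ A := rfl

/-- `‖ζu‖² ≤ |ζ|²‖u‖²`. [cite: Balaban1984PropagatorsI, Prop. 1.2 (1.114) p.36 (the factor |ζ|)] -/
theorem nsq_smulV_le {ζ : Tor (fine n M) → ℝ} {y : Tor M} (hζ : cutInL n M ζ y) (u : Tor (fine n M) × Fin d → ℂ) :
    nsq (smulV n M ζ u) ≤ cutSupL n M ζ ^ 2 * nsq u :=
  nsq_smulV_le_of_majorant n M hζ u (fun i => ‖u i‖) (fun _ => norm_nonneg _) fun _ _ => le_rfl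

/-- restricting a pairing to the support cube: `|⟨q, T⟩| ≤ (Σ_{Δ̃(y′)}|q|²)^{1/2}‖T‖` for `supp T ⊂ Δ̃(y′) × dirs`.
[cite: Balaban1984PropagatorsI, (1.108) p.35 (‖·‖), Prop. 1.2 p.35 (supp J ⊂ Δ̃(y′))] -/
theorem norm_star_dotProduct_le_cube {y' : Tor M} (q T : Tor (fine n M) × Fin d → ℂ)
    (hT : ∀ i, T i ≠ 0 → i.1 ∈ cubeT n M y') :
    ‖star q ⬝ᵥ T‖ ≤ Real.sqrt (∑ i, (if i.1 ∈ cubeT n M y' then ‖q i‖ ^ 2 else 0)) * Real.sqrt (nsq T) := by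
  set q' : Tor (fine n M) × Fin d → ℂ := fun i => if i.1 ∈ cubeT n M y' then q i else 0 with hq'
  have he : star q ⬝ᵥ T = star q' ⬝ᵥ T := by
    simp only [dotProduct, Pi.star_apply]
    refine Finset.sum_congr rfl fun i _ => ?_
    by_cases h : i.1 ∈ cubeT n M y'
    · simp [hq', h]
    · have : T i = 0 := by by_contra h0; exact h (hT i h0)
      simp [this]
  rw [he]
  refine (norm_star_dotProduct_le q' T).trans (le_of_eq ?_)
  congr 2
  unfold nsq
  refine Finset.sum_congr rfl fun i _ => ?_
  by_cases h : i.1 ∈ cubeT n M y' <;> simp [hq', h]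

/-- **(1.114), ENTRY `‖ζG∇*∇*J‖`** for `G = Δ_a⁻¹` on the lattice torus of record, UNDER (1.126), BY DUALITY («G is a symmetric
operator»): `‖ζG∇*∇*T‖ ≤ C₄·e^{−δ|y−y′|}·|ζ|·‖T‖` for `supp ζ ⊂ Δ̃(y)`, `supp T ⊂ Δ̃(y′)`, `0 ≤ δ ≤ δ₁`.
[cite: Balaban1984PropagatorsI, Prop. 1.2 (1.114) p.36, Prop. 1.1 p.33 («G is a symmetric operator»), p.39; proof ours] -/
theorem l2_smulV_GdivT2_le (hn : 1 ≤ n) {a : ℝ} (ha : 0 < a) {δ' C : ℝ} (hδ' : 0 < δ') (hC : 0 ≤ C)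
    (h126 : ∀ i j, ‖dPd n M i j‖ ≤ C * ((n : ℝ) ^ d)⁻¹ * Real.exp (-(δ' * distU n M i.1 j.1)))
    {δ : ℝ} (hδ0 : 0 ≤ δ) (hδ : δ ≤ delta1 d a δ' C) {ζ : Tor (fine n M) → ℝ} {y y' : Tor M} (hζ : cutInL n M ζ y)
    {T : Fin d × Fin d → Tor (fine n M) × Fin d → ℂ} (hT : ∀ p i, T p i ≠ 0 → i.1 ∈ cubeT n M y') :
    l2 (smulV n M ζ ((DeltaA n M a)⁻¹ *ᵥ divT2 n M T))
      ≤ Real.sqrt (C4sq d a δ' C δ) * Real.exp (-(δ * distSite M y y')) * cutSupL n M ζ * l2T T := by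
  set Gm := (DeltaA n M a)⁻¹ with hGm
  set u := smulV n M ζ (Gm *ᵥ divT2 n M T) with hu
  set q := Gm *ᵥ smulV n M ζ u with hq
  have hζ0 : 0 ≤ cutSupL n M ζ := cutSupL_nonneg ζ
  have hR0 : 0 ≤ Real.sqrt (C4sq d a δ' C δ) * Real.exp (-(δ * distSite M y y')) * cutSupL n M ζ :=
    mul_nonneg (mul_nonneg (Real.sqrt_nonneg _) (Real.exp_pos _).le) hζ0
  -- the source ζu is supported in Δ̃(y); its solution q obeys the core bound on Δ̃(y′)
  have hsrc : ∀ i, smulV n M ζ u i ≠ 0 → i.1 ∈ cubeT n M y := by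
    intro i hi
    refine hζ i.1 fun h0 => hi ?_
    simp [smulV, h0]
  have hcore := sum_cube_grad2_le n M hn ha hδ' hC h126 hδ0 hδ y' hsrc (DeltaA_mulVec_G n M hn ha (smulV n M ζ u))
  rw [← hGm, ← hq, distSite_comm M y' y] at hcore
  -- duality: ‖u‖² = ⟨Gζu, ∇*∇*T⟩ = Σ_p ⟨∇_{p₂}∇_{p₁}q, T_p⟩
  have hG : Gmᴴ = Gm := (DeltaA_inv_isHermitian n hn M a ha).eq
  have hdual : ((nsq u : ℝ) : ℂ) = ∑ p : Fin d × Fin d, star (grad2 n M q (p.2, p.1)) ⬝ᵥ T p := by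
    rw [← star_dotProduct_self u]
    have hA : star u ⬝ᵥ u = star (smulV n M ζ u) ⬝ᵥ (Gm *ᵥ divT2 n M T) := by
      rw [smulV_eq_wmul, star_wmul_dotProduct, ← smulV_eq_wmul]
    have hB : star (smulV n M ζ u) ⬝ᵥ (Gm *ᵥ divT2 n M T) = star q ⬝ᵥ divT2 n M T := by
      rw [hq, ← star_dotProduct_conjTranspose_mulVec, hG]
    rw [hA, hB, divT2, dotProduct_sum]
    refine Finset.sum_congr rfl fun p _ => ?_
    rw [Matrix.star_eq_conjTranspose, Matrix.star_eq_conjTranspose, star_dotProduct_conjTranspose_mulVec,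
      star_dotProduct_conjTranspose_mulVec]
    rfl
  -- bound each pairing on the support cube of T
  have hA0 : ∀ p : Fin d × Fin d, 0 ≤ ∑ i, (if i.1 ∈ cubeT n M y' then ‖grad2 n M q p i‖ ^ 2 else 0) :=
    fun p => Finset.sum_nonneg fun i _ => by split_ifs <;> positivity
  have hpair : nsq u ≤ ∑ p : Fin d × Fin d,
      Real.sqrt (∑ i, (if i.1 ∈ cubeT n M y' then ‖grad2 n M q (p.2, p.1) i‖ ^ 2 else 0)) * Real.sqrt (nsq (T p)) := by
    have h1 : nsq u = ‖((nsq u : ℝ) : ℂ)‖ := by rw [Complex.norm_real, Real.norm_of_nonneg (nsq_nonneg u)]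
    rw [h1, hdual]
    refine (norm_sum_le _ _).trans (Finset.sum_le_sum fun p _ => ?_)
    exact norm_star_dotProduct_le_cube n M _ _ (hT p)
  -- Cauchy–Schwarz over the pairs and the swap of the pair index
  have hCS : ∑ p : Fin d × Fin d,
      Real.sqrt (∑ i, (if i.1 ∈ cubeT n M y' then ‖grad2 n M q (p.2, p.1) i‖ ^ 2 else 0)) * Real.sqrt (nsq (T p))
      ≤ Real.sqrt (∑ p : Fin d × Fin d, ∑ i, (if i.1 ∈ cubeT n M y' then ‖grad2 n M q (p.2, p.1) i‖ ^ 2 else 0))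
        * Real.sqrt (∑ p : Fin d × Fin d, nsq (T p)) :=
    Real.sum_sqrt_mul_sqrt_le _ (fun p => hA0 (p.2, p.1)) (fun p => nsq_nonneg _)
  have hswap : ∑ p : Fin d × Fin d, ∑ i, (if i.1 ∈ cubeT n M y' then ‖grad2 n M q (p.2, p.1) i‖ ^ 2 else 0)
      = ∑ p : Fin d × Fin d, ∑ i, (if i.1 ∈ cubeT n M y' then ‖grad2 n M q p i‖ ^ 2 else 0) :=
    (Equiv.prodComm (Fin d) (Fin d)).sum_comp
      (fun p : Fin d × Fin d => ∑ i, (if i.1 ∈ cubeT n M y' then ‖grad2 n M q p i‖ ^ 2 else 0))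
  rw [hswap] at hCS
  -- assemble: ‖u‖² ≤ C₄ e^{−δD} ‖ζu‖ ‖T‖ ≤ (C₄ e^{−δD}|ζ| ‖T‖) ‖u‖
  have hsrc2 : nsq (smulV n M ζ u) ≤ cutSupL n M ζ ^ 2 * nsq u := nsq_smulV_le n M hζ u
  have hq1 : Real.sqrt (∑ p : Fin d × Fin d, ∑ i, (if i.1 ∈ cubeT n M y' then ‖grad2 n M q p i‖ ^ 2 else 0))
      ≤ Real.sqrt (C4sq d a δ' C δ) * Real.exp (-(δ * distSite M y y')) * cutSupL n M ζ * l2 u := by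
    refine (Real.sqrt_le_sqrt (hcore.trans (mul_le_mul_of_nonneg_left hsrc2 (by
      exact mul_nonneg (C4sq_nonneg d a δ' C δ) (Real.exp_pos _).le)))).trans (le_of_eq ?_)
    unfold l2
    rw [show C4sq d a δ' C δ * Real.exp (-(2 * (δ * distSite M y y'))) * (cutSupL n M ζ ^ 2 * nsq u)
      = (Real.sqrt (C4sq d a δ' C δ) * Real.exp (-(δ * distSite M y y')) * cutSupL n M ζ) ^ 2 * nsq u by
        rw [mul_pow, mul_pow, Real.sq_sqrt (C4sq_nonneg d a δ' C δ), ← Real.exp_nat_mul]; ring_nf,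
      Real.sqrt_mul (sq_nonneg _), Real.sqrt_sq hR0]
  have hmain : nsq u ≤ (Real.sqrt (C4sq d a δ' C δ) * Real.exp (-(δ * distSite M y y')) * cutSupL n M ζ * l2T T) * l2 u := by
    calc nsq u ≤ _ := hpair
      _ ≤ _ := hCS
      _ ≤ (Real.sqrt (C4sq d a δ' C δ) * Real.exp (-(δ * distSite M y y')) * cutSupL n M ζ * l2 u) * l2T T := by
          unfold l2T
          exact mul_le_mul_of_nonneg_right hq1 (Real.sqrt_nonneg _)
      _ = _ := by ring
  -- divide by ‖u‖
  have hu0 := l2_nonneg u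
  rcases hu0.eq_or_lt with h0 | hpos
  · rw [← h0]; exact mul_nonneg hR0 (l2T_nonneg _)
  · have : l2 u * l2 u ≤ (Real.sqrt (C4sq d a δ' C δ) * Real.exp (-(δ * distSite M y y')) * cutSupL n M ζ * l2T T) * l2 u := by
      rw [← sq, l2_sq]; exact hmain
    exact le_of_mul_le_mul_right this hpos

end Entries

end

end Literature.MathematicalPhysics.QuantumFieldTheory.Balaban1983to89.B5Local114GLatticeSecond
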